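import Literature.NumberTheory.LFunctions.SuzukiScrewLineProofs
import Literature.NumberTheory.LFunctions.LagariasXiStructureFunction
import Literature.NumberTheory.LFunctions.RiemannXiLogDeriv
import Literature.NumberTheory.LFunctions.ZetaLogDerivDisc
import Literature.NumberTheory.LFunctions.ZetaLogDerivSeries
import Literature.Analysis.SpecialFunctions.DigammaLogBound
import Literature.NumberTheory.LFunctions.RiemannSiegelFacts
import Literature.NumberTheory.LFunctions.WeilMellinBounds
import Literature.NumberTheory.LFunctions.SuzukiScrewLineDoorProofs
import Mathlib.MeasureTheory.Integral.Prod
import HarnessLib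

/-!
# Suzuki's screw line `𝔖_t` and `P̂_φ` are square integrable — CJM Props 1.2, 1.3 (RH-FREE)

LINE 1 — LABEL: RH-FREE corpus theorems. We DISCHARGE `Suzuki2025_prop12` and `Suzuki2025_prop13`
of `SuzukiScrewLine.lean` (M. Suzuki, *On the Hilbert space derived from the Weil distribution*,
Canad. J. Math. 2025 = arXiv:2301.00421v3; Prop 1.2 = arXiv:2209.04658 Prop 1.1, Prop 1.3 = ibid.
Prop 1.2): for every real `t`, `x ↦ 𝔖_t(x)` belongs to `L²(ℝ)`; for every `φ ∈ C_c^∞(ℝ)`,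
`x ↦ P̂_φ(x) = ∫ 𝔖_t♯(x)φ(t)dt` belongs to `L²(ℝ)`. bears_on: B-C/B-P (COLUMN 6 DBR). WHAT THIS IS
NOT: unconditional analytic lemmas about explicit functions; nothing here bears on the truth of RH.

## The printed proof (§3.2, TeX l.985–1015) and what we formalize

Suzuki: `|Θ| = 1` on `ℝ`; the simple poles of `𝔓_t` at `γ ∈ Γ` are cancelled by the zeros of
`1 + Θ`; away from them `𝔖_t(z) ≪ |z|^{-1} log|z|` by `(Γ′/Γ)(¼+iz/2) ≪ log|z|`,
`ζ′/ζ(½−iz) = Σ_{|Re z−γ|≤1} i/(z−γ) + O(log|z|)` [Titchmarsh 9.6 (A)] and the zero count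
[Titchmarsh 9.2]. We make the cancellation QUANTITATIVE and global, which avoids the partial-fraction
input altogether: writing `s = ½ − ix`, `A(z) = ξ(½−iz)` (so that on the real line `ξ(s)` is real and
`ξ′(s)` purely imaginary, `conj_riemannXi_critical`, `conj_deriv_riemannXi_critical`), one has
`1 + Θ_ξ♯(x) = conj(2ξ(s)/E_ξ(x))` and `ξ′/ξ(s)`, whence the pointwise identity
`|(1 + Θ_ξ♯(x)) · ξ′/ξ(s)| = 2|ξ′(s)|/|ξ(s)+ξ′(s)| ≤ 2` for EVERY real `x`
(`norm_one_add_sharp_theta_mul_logDeriv_xi_le`). Since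
`ζ′/ζ(s) = ξ′/ξ(s) − 1/s − 1/(s−1) − Γ_ℝ′/Γ_ℝ(s)` (`logDeriv_riemannXi_eq`, `logDeriv_riemannZeta_eq`)
and `|Γ_ℝ′/Γ_ℝ(½−ix)| ≤ ½log π + ½|ψ(¼−ix/2)| ≪ log(2+|x|)` (`norm_digamma_le_log`, and a Lipschitz
bound from the series `hasSum_one_div_sub_one_div_digamma` near `x = 0`), every term of (1.6) times
`i(1+Θ♯)/2` is `≪_t (1 + log(2+|x|))/(1+|x|)`, uniformly in `x ∈ ℝ` (no exceptional set: at the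
junk points of the pointwise transcription the relevant terms vanish). Hence
`|𝔖_t(x)| ≤ K_t (1+|x|)^{-3/4}` and `𝔖_t ∈ L²(ℝ)`; for `t = 0`, `𝔖_0 ≡ 0` (`screwLine_zero`).
Prop 1.3 (printed proof: "obtained uniformly on every compact subset of `t` … Minkowski"): the
constant is uniform for `|t| ≤ R` (`norm_screwLine_le_log_unif`; the Hurwitz–Lerch bracket is
bounded by a harmonic sum, `‖B(t,x)‖ ≤ 8(1 + log(2+|x|))` for all `t`), so
`|P̂_φ(x)| ≤ 6K_R‖φ‖₁(1+|x|)^{-3/4}`; measurability of `x ↦ P̂_φ(x)` is Fubini measurability of the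
jointly measurable integrand (`measurable_screwLine_uncurry`).

## Also in this file (appended)

* CJM Lemma 3.2 (i),(ii): `ScrewLineL2.Suzuki2025_lemma32_subadd`, `…_absHom` (RH-FREE, Minkowski in
  `L²` via Prop 1.3) and `…_of_definite` (the fact `Suzuki2025_lemma32` ⇐ its clause (iii)).
* CJM Thm 4.4 ⇐ Thm 4.2: `Suzuki2025_thm44_mp_of_thm42` ((4.8) from (4.4) by Fubini),
  `Suzuki2025_thm44_of_thm42`; (4.10) for `D`: `zetaScrewForm_univ_suzukiD`; Thm 1.4 ⇐ Thm 4.4 ⇐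
  Thm 4.2: `Suzuki2025_thm14_of_thm44`, `Suzuki2025_thm14_of_thm42`.

## References
* M. Suzuki, Canad. J. Math. 2025, Props 1.2, 1.3 and §3.2. [Suzuki2025WeilHilbertSpace]
* E. C. Titchmarsh, *The theory of the Riemann zeta-function*, §9.6. [Titchmarsh1986]
-/

noncomputable section

open MeasureTheory Complex Filter Set Real
open Literature.Analysis.DeBrangesSpaces (sharp sharp_ofReal)
open Literature.Analysis.SpecialFunctions.Complex (hasSum_one_div_sub_one_div_digamma
  norm_digamma_le_log)
open scoped ComplexConjugate Topology

namespace Literature.NumberTheory.LFunctions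

namespace ScrewLineL2

/-! ## Elementary bounds for the factors of (1.6) on the real line -/

/-- `‖(e^{−ixu} − 1)/(ix)‖ ≤ u` for `u ≥ 0` (and the junk value `0` at `x = 0`). [folklore] -/
private theorem norm_expFactor_le_self (x u : ℝ) (hu : 0 ≤ u) :
    ‖(cexp (-(I * x * u)) - 1) / (I * x)‖ ≤ u := by
  by_cases hx : x = 0
  · simp [hx, hu]
  · have h1 : ‖cexp (-(I * x * u)) - 1‖ ≤ |x| * u := by
      have h := Real.norm_exp_I_mul_ofReal_sub_one_le (x := -(x * u))
      have e : cexp (I * ((-(x * u) : ℝ) : ℂ)) = cexp (-(I * x * u)) := by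
        push_cast; ring_nf
      rw [e] at h
      refine h.trans ?_
      rw [Real.norm_eq_abs, abs_neg, abs_mul, abs_of_nonneg hu]
    rw [norm_div, norm_mul, Complex.norm_I, one_mul, Complex.norm_real, Real.norm_eq_abs,
      div_le_iff₀ (abs_pos.2 hx)]
    linarith
/-- `‖(e^{−ixu} − 1)/(ix)‖ ≤ 2/|x|` (junk `0 ≤ 0` at `x = 0`). [folklore] -/
private theorem norm_expFactor_le_two_div (x u : ℝ) :
    ‖(cexp (-(I * x * u)) - 1) / (I * x)‖ ≤ 2 / |x| := by
  by_cases hx : x = 0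
  · simp [hx]
  · have h1 : ‖cexp (-(I * x * u)) - 1‖ ≤ 2 := by
      have e : cexp (-(I * x * u)) = cexp (((-(x * u) : ℝ) : ℂ) * I) := by
        push_cast; ring_nf
      calc ‖cexp (-(I * x * u)) - 1‖ ≤ ‖cexp (-(I * x * u))‖ + ‖(1 : ℂ)‖ := norm_sub_le _ _
        _ = 2 := by rw [e, Complex.norm_exp_ofReal_mul_I, norm_one]; norm_num
    rw [norm_div, norm_mul, Complex.norm_I, one_mul, Complex.norm_real, Real.norm_eq_abs]
    exact div_le_div_of_nonneg_right h1 (abs_nonneg x)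

/-- Both bounds combined: `‖(e^{−ixu} − 1)/(ix)‖ ≤ (2a + 4)/(1 + |x|)` for `0 ≤ u ≤ a`. [folklore] -/
private theorem norm_expFactor_le (x : ℝ) {u a : ℝ} (hu : 0 ≤ u) (hua : u ≤ a) :
    ‖(cexp (-(I * x * u)) - 1) / (I * x)‖ ≤ (2 * a + 4) / (1 + |x|) := by
  have ha : 0 ≤ a := hu.trans hua
  have hD : 0 < 1 + |x| := by positivity
  rw [le_div_iff₀ hD]
  rcases le_or_gt |x| 1 with hx | hx
  · have h := norm_expFactor_le_self x u hu
    have hn := norm_nonneg ((cexp (-(I * x * u)) - 1) / (I * x))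
    nlinarith
  · have h := norm_expFactor_le_two_div x u
    have hx0 : 0 < |x| := by linarith
    rw [le_div_iff₀ hx0] at h
    have hn := norm_nonneg ((cexp (-(I * x * u)) - 1) / (I * x))
    nlinarith

/-- `‖1 + 2ix‖ ≥ (1+|x|)/2` and `‖1 − 2ix‖ ≥ (1+|x|)/2`. [folklore] -/
private theorem half_one_add_abs_le_norm (x : ℝ) (ε : ℝ) (hε : ε = 1 ∨ ε = -1) :
    (1 + |x|) / 2 ≤ ‖(1 : ℂ) + ε * (2 * I * x)‖ := by
  have hre : ((1 : ℂ) + ε * (2 * I * x)).re = 1 := by simp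
  have him : |((1 : ℂ) + ε * (2 * I * x)).im| = 2 * |x| := by
    rcases hε with h | h <;> simp [h, abs_mul]
  have h1 : (1 : ℝ) ≤ ‖(1 : ℂ) + ε * (2 * I * x)‖ := by
    have := Complex.abs_re_le_norm ((1 : ℂ) + ε * (2 * I * x))
    rwa [hre, abs_one] at this
  have h2 : 2 * |x| ≤ ‖(1 : ℂ) + ε * (2 * I * x)‖ := by
    have := Complex.abs_im_le_norm ((1 : ℂ) + ε * (2 * I * x))
    rwa [him] at this
  linarith [abs_nonneg x]

/-- `‖c/(1 ± 2ix)‖ ≤ 2‖c‖/(1+|x|)`. [folklore] -/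
private theorem norm_div_one_add_le (c : ℂ) (x : ℝ) (ε : ℝ) (hε : ε = 1 ∨ ε = -1) :
    ‖c / ((1 : ℂ) + ε * (2 * I * x))‖ ≤ 2 * ‖c‖ / (1 + |x|) := by
  have hD : 0 < 1 + |x| := by positivity
  have hd := half_one_add_abs_le_norm x ε hε
  have hpos : 0 < ‖(1 : ℂ) + ε * (2 * I * x)‖ := lt_of_lt_of_le (by positivity) hd
  rw [norm_div, div_le_div_iff₀ hpos hD]
  nlinarith [norm_nonneg c]

/-- On the critical line `‖1/s‖ ≤ 2` and `‖1/(s−1)‖ ≤ 2`, `s = ½ − ix`. [folklore] -/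
private theorem norm_inv_critical_le (x : ℝ) :
    ‖(1 / 2 - I * x : ℂ)⁻¹‖ ≤ 2 ∧ ‖((1 / 2 - I * x : ℂ) - 1)⁻¹‖ ≤ 2 := by
  have h1 : (1 / 2 : ℝ) ≤ ‖(1 / 2 - I * x : ℂ)‖ := by
    have := Complex.abs_re_le_norm (1 / 2 - I * x : ℂ)
    simpa using this
  have h2 : (1 / 2 : ℝ) ≤ ‖((1 / 2 - I * x : ℂ) - 1)‖ := by
    have := Complex.abs_re_le_norm ((1 / 2 - I * x : ℂ) - 1)
    norm_num at this
    simpa using this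
  constructor
  · rw [norm_inv, inv_le_comm₀ (lt_of_lt_of_le (by norm_num) h1) two_pos]
    linarith
  · rw [norm_inv, inv_le_comm₀ (lt_of_lt_of_le (by norm_num) h2) two_pos]
    linarith

/-! ## The digamma factor on the line `Re w = ¼` -/

/-- The series `Σ (n + ¼)^{-2}` converges. [folklore] -/
private theorem summable_quarterSq : Summable (fun n : ℕ ↦ 1 / ((n : ℝ) + 1 / 4) ^ 2) := by
  have h : Summable (fun n : ℕ ↦ (16 : ℝ) / ((n : ℝ) + 1) ^ 2) := by
    have h1 : Summable (fun n : ℕ ↦ 1 / ((n + 1 : ℕ) : ℝ) ^ 2) :=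
      (summable_nat_add_iff 1).mpr (Real.summable_one_div_nat_pow.mpr one_lt_two)
    simpa [div_eq_mul_inv] using h1.mul_left 16
  refine h.of_nonneg_of_le (fun n ↦ by positivity) fun n ↦ ?_
  have hn : (0 : ℝ) ≤ n := n.cast_nonneg
  rw [div_le_div_iff₀ (by positivity) (by positivity)]
  nlinarith

/-- `0 ≤ S`. [folklore] -/
private theorem quarterSqSum_nonneg : 0 ≤ ∑' n : ℕ, 1 / ((n : ℝ) + 1 / 4) ^ 2 :=
  tsum_nonneg fun n ↦ by positivity

/-- **Lipschitz bound along `Re w = ¼`**: `‖ψ(¼ − ix/2) − ψ(¼)‖ ≤ S·|x|/2`, from the series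
`ψ(w) − ψ(¼) = Σ (w − ¼)/((n+¼)(n+w))` (`hasSum_one_div_sub_one_div_digamma`) and `|n + w| ≥ n + ¼`.
[folklore] -/
private theorem norm_digamma_sub_quarter_le (x : ℝ) :
    ‖Complex.digamma (1 / 4 - I * x / 2) - Complex.digamma (1 / 4)‖ ≤
      (∑' n : ℕ, 1 / ((n : ℝ) + 1 / 4) ^ 2) * (|x| / 2) := by
  set w : ℂ := 1 / 4 - I * x / 2 with hw
  have hwre : w.re = 1 / 4 := by simp [hw]
  have hw0 : 0 < w.re := by rw [hwre]; norm_num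
  have hq : (0 : ℝ) < ((1 / 4 : ℂ)).re := by norm_num
  have h1 := hasSum_one_div_sub_one_div_digamma hw0
  have h2 := hasSum_one_div_sub_one_div_digamma hq
  have h3 : HasSum (fun k : ℕ ↦ (1 / ((k : ℂ) + 1) - 1 / (w + k)) -
      (1 / ((k : ℂ) + 1) - 1 / (1 / 4 + k))) (Complex.digamma w - Complex.digamma (1 / 4)) := by
    have h := h1.sub h2
    rwa [add_sub_add_right_eq_sub] at h
  have hwq : ‖w - 1 / 4‖ = |x| / 2 := by
    have : w - 1 / 4 = -(((x / 2 : ℝ) : ℂ) * I) := by rw [hw]; push_cast; ring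
    rw [this, norm_neg, norm_mul, Complex.norm_I, mul_one, Complex.norm_real, Real.norm_eq_abs,
      abs_div, abs_two]
  have hg : HasSum (fun k : ℕ ↦ |x| / 2 * (1 / ((k : ℝ) + 1 / 4) ^ 2)) (|x| / 2 * (∑' n : ℕ, 1 / ((n : ℝ) + 1 / 4) ^ 2)) :=
    summable_quarterSq.hasSum.mul_left (|x| / 2)
  rw [mul_comm]
  refine HasSum.norm_le_of_bounded h3 hg fun k ↦ ?_
  · have hk : (0 : ℝ) ≤ k := k.cast_nonneg
    have hqk : ((1 : ℂ) / 4 + k) ≠ 0 := by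
      intro h; have := congrArg Complex.re h; simp at this; linarith
    have hwk : (w + k) ≠ 0 := by
      intro h; have := congrArg Complex.re h; simp [hw] at this; linarith
    have hterm : (1 / ((k : ℂ) + 1) - 1 / (w + k)) - (1 / ((k : ℂ) + 1) - 1 / (1 / 4 + k)) =
        (w - 1 / 4) / ((1 / 4 + k) * (w + k)) := by
      rw [show (1 / ((k : ℂ) + 1) - 1 / (w + k)) - (1 / ((k : ℂ) + 1) - 1 / (1 / 4 + k)) =
          1 / (1 / 4 + k) - 1 / (w + k) by ring, div_sub_div _ _ hqk hwk]
      congr 1; ring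
    rw [hterm, norm_div, norm_mul, hwq]
    have hqk' : ‖(1 : ℂ) / 4 + k‖ = (k : ℝ) + 1 / 4 := by
      have : ((1 : ℂ) / 4 + k) = (((k : ℝ) + 1 / 4 : ℝ) : ℂ) := by push_cast; ring
      rw [this, Complex.norm_real, Real.norm_eq_abs, abs_of_pos (by positivity)]
    have hwk' : (k : ℝ) + 1 / 4 ≤ ‖w + k‖ := by
      have := Complex.abs_re_le_norm (w + k)
      simp [hw] at this
      rw [abs_of_pos (by positivity)] at this
      linarith
    rw [hqk']
    have hpos : (0 : ℝ) < (k : ℝ) + 1 / 4 := by positivity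
    calc |x| / 2 / (((k : ℝ) + 1 / 4) * ‖w + k‖)
        ≤ |x| / 2 / (((k : ℝ) + 1 / 4) * ((k : ℝ) + 1 / 4)) := by
          gcongr
      _ = |x| / 2 * (1 / ((k : ℝ) + 1 / 4) ^ 2) := by rw [pow_two]; ring

/-- **Digamma on the line `Re w = ¼`**: `‖ψ(¼ − ix/2)‖ ≤ (‖ψ(¼)‖ + S/2 + 8) + log(2 + |x|)` for every
real `x` (Lipschitz bound for `|x| ≤ 1`, `norm_digamma_le_log` for `|x| ≥ 1`). [folklore] -/
private theorem norm_digamma_quarter_line_le (x : ℝ) :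
    ‖Complex.digamma (1 / 4 - I * x / 2)‖ ≤
      (‖Complex.digamma (1 / 4)‖ + (∑' n : ℕ, 1 / ((n : ℝ) + 1 / 4) ^ 2) / 2 + 8) + Real.log (2 + |x|) := by
  have hlog : 0 ≤ Real.log (2 + |x|) := Real.log_nonneg (by linarith [abs_nonneg x])
  have hS := quarterSqSum_nonneg
  rcases le_or_gt |x| 1 with hx | hx
  · have h := norm_digamma_sub_quarter_le x
    have h' : ‖Complex.digamma (1 / 4 - I * x / 2)‖ ≤
        ‖Complex.digamma (1 / 4)‖ + (∑' n : ℕ, 1 / ((n : ℝ) + 1 / 4) ^ 2) * (|x| / 2) := by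
      calc ‖Complex.digamma (1 / 4 - I * x / 2)‖
          = ‖Complex.digamma (1 / 4) + (Complex.digamma (1 / 4 - I * x / 2) -
              Complex.digamma (1 / 4))‖ := by rw [add_sub_cancel]
        _ ≤ _ := (norm_add_le _ _).trans (by linarith)
    have : (∑' n : ℕ, 1 / ((n : ℝ) + 1 / 4) ^ 2) * (|x| / 2) ≤ (∑' n : ℕ, 1 / ((n : ℝ) + 1 / 4) ^ 2) / 2 := by nlinarith [abs_nonneg x]
    linarith
  · set w : ℂ := 1 / 4 - I * x / 2 with hw
    have hw0 : 0 < w.re := by simp [hw]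
    have hwim : 1 / 2 ≤ |w.im| := by
      have : w.im = -(x / 2) := by simp [hw]
      rw [this, abs_neg, abs_div, abs_two]; linarith
    have h := norm_digamma_le_log hw0 hwim
    have hwn : ‖w‖ ≤ 1 + |x| := by
      have : w = (((1 / 4 : ℝ)) : ℂ) + -((((x / 2 : ℝ)) : ℂ) * I) := by rw [hw]; push_cast; ring
      rw [this]
      refine (norm_add_le _ _).trans ?_
      rw [norm_neg, norm_mul, Complex.norm_I, mul_one, Complex.norm_real, Complex.norm_real,
        Real.norm_eq_abs, Real.norm_eq_abs]
      have e1 : |(1 / 4 : ℝ)| = 1 / 4 := abs_of_pos (by norm_num)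
      have e2 : |x / 2| = |x| / 2 := by rw [abs_div, abs_two]
      rw [e1, e2]; linarith [abs_nonneg x]
    have hlog2 : Real.log (1 + ‖w‖) ≤ Real.log (2 + |x|) :=
      Real.log_le_log (by positivity) (by linarith)
    linarith [norm_nonneg (Complex.digamma (1 / 4))]

/-- `Γ_ℝ′/Γ_ℝ(½ − ix) = −½ log π + ½ ψ(¼ − ix/2)`, hence
`‖Γ_ℝ′/Γ_ℝ(½ − ix)‖ ≤ 1 + ½‖ψ(¼ − ix/2)‖` (`log π < 2`). [folklore] -/
private theorem norm_logDeriv_Gammaℝ_critical_le (x : ℝ) :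
    ‖logDeriv Gammaℝ (1 / 2 - I * x)‖ ≤ 1 + ‖Complex.digamma (1 / 4 - I * x / 2)‖ / 2 := by
  have hs : ∀ m : ℕ, (1 / 2 - I * x : ℂ) / 2 ≠ -m := by
    intro m h
    have := congrArg Complex.re h
    simp at this
    have hm : (0 : ℝ) ≤ m := m.cast_nonneg
    linarith
  rw [logDeriv_Gammaℝ hs]
  have hw : (1 / 2 - I * x : ℂ) / 2 = 1 / 4 - I * x / 2 := by ring
  rw [hw]
  have hpi1 : (1 : ℝ) < π := by linarith [Real.pi_gt_three]
  have hπ : ‖-(Complex.log π) / 2‖ ≤ 1 := by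
    rw [norm_div, norm_neg, ← Complex.ofReal_log Real.pi_pos.le, Complex.norm_real,
      Real.norm_eq_abs, abs_of_pos (Real.log_pos hpi1), Complex.norm_two]
    have := log_pi_lt_two
    linarith
  have hd : ‖Complex.digamma (1 / 4 - I * x / 2) / 2‖ = ‖Complex.digamma (1 / 4 - I * x / 2)‖ / 2 := by
    rw [norm_div, Complex.norm_two]
  calc ‖-(Complex.log π) / 2 + Complex.digamma (1 / 4 - I * x / 2) / 2‖
      ≤ ‖-(Complex.log π) / 2‖ + ‖Complex.digamma (1 / 4 - I * x / 2) / 2‖ := norm_add_le _ _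
    _ ≤ 1 + ‖Complex.digamma (1 / 4 - I * x / 2)‖ / 2 := by rw [hd]; linarith

/-! ## The cancellation `|(1 + Θ♯)·ξ′/ξ| ≤ 2` on the real line -/

/-- **The cancellation** (CJM §3.2: "the poles of `𝔓_t` at `γ` cancel against the zeros of
`1 + Θ`", made quantitative): for EVERY real `x`, with `s = ½ − ix`,
`‖(1 + Θ_ξ♯(x)) · ξ′(s)/ξ(s)‖ ≤ 2`. Indeed `1 + Θ_ξ(x) = 2ξ(s)/E_ξ(x)` (`E♯ = ξ − ξ′`), `ξ(s)` is real
and `ξ′(s)` purely imaginary, so `|ξ′(s)| ≤ |ξ(s) + ξ′(s)| = |E_ξ(x)|`; at the junk points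
(`ξ(s) = 0` or `E_ξ(x) = 0`, where `ξ(s) = 0` too) the left side is `0`.
[cite: Suzuki2025WeilHilbertSpace, §3.2 (TeX l.989–995)] -/
theorem norm_one_add_sharp_theta_mul_logDeriv_xi_le (x : ℝ) :
    ‖(1 + sharp lagariasTheta x) * logDeriv riemannXi (1 / 2 - I * x)‖ ≤ 2 := by
  set ξ₀ : ℂ := riemannXi (1 / 2 - I * x) with hξ₀
  set ξ₁ : ℂ := deriv riemannXi (1 / 2 - I * x) with hξ₁
  have hE : lagariasE x = ξ₀ + ξ₁ := rfl
  have hEs : sharp lagariasE x = ξ₀ - ξ₁ := sharp_lagariasE x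
  rw [sharp_ofReal, logDeriv_apply, ← hξ₀, ← hξ₁]
  by_cases hξ : ξ₀ = 0
  · simp [hξ]
  have hE0 : lagariasE x ≠ 0 := fun h ↦ hξ ((lagariasE_ofReal_eq_zero_iff x).1 h).1
  have h1 : 1 + lagariasTheta x = 2 * ξ₀ / lagariasE x := by
    unfold lagariasTheta
    rw [hEs, eq_div_iff hE0, hE]
    have hE0' : ξ₀ + ξ₁ ≠ 0 := hE ▸ hE0
    field_simp
    ring
  have hconj : (starRingEnd ℂ) (1 + lagariasTheta x) = 1 + (starRingEnd ℂ) (lagariasTheta x) := by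
    rw [map_add, map_one]
  rw [← hconj, norm_mul, Complex.norm_conj, h1, norm_div, norm_div, norm_mul, Complex.norm_two, hE]
  -- `ξ₀` real, `ξ₁` imaginary on the critical line
  have hr : ξ₀.im = 0 := Complex.conj_eq_iff_im.mp (conj_riemannXi_critical x)
  have hi : ξ₁.re = 0 := by
    have h := congrArg Complex.re (conj_deriv_riemannXi_critical x)
    rw [Complex.conj_re, Complex.neg_re] at h
    change ξ₁.re = -ξ₁.re at h
    linarith
  have key : ‖ξ₁‖ ≤ ‖ξ₀ + ξ₁‖ := by
    have e1 : ‖ξ₁‖ ^ 2 = ξ₁.im ^ 2 := by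
      rw [Complex.sq_norm, Complex.normSq_apply, hi]; ring
    have e2 : ‖ξ₀ + ξ₁‖ ^ 2 = ξ₀.re ^ 2 + ξ₁.im ^ 2 := by
      rw [Complex.sq_norm, Complex.normSq_apply, Complex.add_re, Complex.add_im, hr, hi]; ring
    have : ‖ξ₁‖ ^ 2 ≤ ‖ξ₀ + ξ₁‖ ^ 2 := by rw [e1, e2]; nlinarith
    exact (pow_le_pow_iff_left₀ (norm_nonneg _) (norm_nonneg _) two_ne_zero).mp this
  have hEn : 0 < ‖ξ₀ + ξ₁‖ := norm_pos_iff.2 (hE ▸ hE0)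
  have hξn : 0 < ‖ξ₀‖ := norm_pos_iff.2 hξ
  calc 2 * ‖ξ₀‖ / ‖ξ₀ + ξ₁‖ * (‖ξ₁‖ / ‖ξ₀‖) = 2 * (‖ξ₁‖ / ‖ξ₀ + ξ₁‖) := by
        field_simp
    _ ≤ 2 * 1 := by
        gcongr
        rw [div_le_one hEn]; exact key
    _ = 2 := by ring

/-- `ζ′/ζ(s) = ξ′/ξ(s) − 1/s − 1/(s−1) − Γ_ℝ′/Γ_ℝ(s)` at `s = ½ − ix` with `ζ(s) ≠ 0`
(`ξ(s) = (s/2)Γ_ℝ(s)(s−1)ζ(s)`). [folklore] -/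
private theorem logDeriv_zeta_critical_eq {x : ℝ} (hζ : riemannZeta (1 / 2 - I * x) ≠ 0) :
    deriv riemannZeta (1 / 2 - I * x) / riemannZeta (1 / 2 - I * x) =
      logDeriv riemannXi (1 / 2 - I * x) - (1 / 2 - I * x : ℂ)⁻¹ -
        ((1 / 2 - I * x : ℂ) - 1)⁻¹ - logDeriv Gammaℝ (1 / 2 - I * x) := by
  set s : ℂ := 1 / 2 - I * x with hs
  have hs1 : s ≠ 1 := by
    intro h; have := congrArg Complex.re h; simp [hs] at this
  have hre : 0 < s.re := by simp [hs]
  have hζ₁ : riemannZeta₁ s ≠ 0 := by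
    rw [riemannZeta₁_eq_mul hs1]; exact mul_ne_zero (sub_ne_zero.2 hs1) hζ
  have h1 := logDeriv_riemannZeta_eq hs1 hζ
  have h2 := logDeriv_riemannXi_eq hre hζ₁
  rw [← logDeriv_apply, h1, h2]
  ring

/-! ## The Hurwitz–Lerch bracket -/

/-- The `n`-th term of `screwLerchBracket t x` for real `x`: norm at most `(|x|/2)(n+¼)^{-2}`
(`|1/(n+w) − 1/(n+¼)| = |w − ¼|/(|n+w|(n+¼))`, `w = ¼ − ix/2`). [folklore] -/
private theorem norm_lerchTerm_le (t x : ℝ) (n : ℕ) :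
    ‖(Real.exp (-(2 * |t| * n)) : ℂ) *
        (1 / ((n : ℂ) + (1 / 2 - I * x) / 2) - 1 / ((n : ℂ) + 1 / 4))‖ ≤
      |x| / 2 * (1 / ((n : ℝ) + 1 / 4) ^ 2) := by
  have hk : (0 : ℝ) ≤ n := n.cast_nonneg
  have hq : ((n : ℂ) + 1 / 4) ≠ 0 := by
    intro h; have := congrArg Complex.re h; simp at this; linarith
  have hw : ((n : ℂ) + (1 / 2 - I * x) / 2) ≠ 0 := by
    intro h; have := congrArg Complex.re h; simp at this; linarith
  have hexp : ‖(Real.exp (-(2 * |t| * n)) : ℂ)‖ ≤ 1 := by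
    rw [Complex.norm_real, Real.norm_eq_abs, abs_of_pos (Real.exp_pos _), Real.exp_le_one_iff]
    have : 0 ≤ 2 * |t| * n := by positivity
    linarith
  have hdiff : 1 / ((n : ℂ) + (1 / 2 - I * x) / 2) - 1 / ((n : ℂ) + 1 / 4) =
      (((x / 2 : ℝ) : ℂ) * I) / (((n : ℂ) + (1 / 2 - I * x) / 2) * ((n : ℂ) + 1 / 4)) := by
    rw [div_sub_div _ _ hw hq]
    congr 1; push_cast; ring
  have hq' : ‖(n : ℂ) + 1 / 4‖ = (n : ℝ) + 1 / 4 := by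
    have : ((n : ℂ) + 1 / 4) = (((n : ℝ) + 1 / 4 : ℝ) : ℂ) := by push_cast; ring
    rw [this, Complex.norm_real, Real.norm_eq_abs, abs_of_pos (by positivity)]
  have hw' : (n : ℝ) + 1 / 4 ≤ ‖(n : ℂ) + (1 / 2 - I * x) / 2‖ := by
    have := Complex.abs_re_le_norm ((n : ℂ) + (1 / 2 - I * x) / 2)
    simp at this
    rw [abs_of_pos (by positivity)] at this
    linarith
  have hpos : (0 : ℝ) < (n : ℝ) + 1 / 4 := by positivity
  have hnum : ‖(((x / 2 : ℝ) : ℂ) * I)‖ = |x| / 2 := by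
    rw [norm_mul, Complex.norm_I, mul_one, Complex.norm_real, Real.norm_eq_abs, abs_div, abs_two]
  rw [norm_mul, hdiff, norm_div, hnum, norm_mul, hq']
  calc ‖(Real.exp (-(2 * |t| * n)) : ℂ)‖ * (|x| / 2 / (‖(n : ℂ) + (1 / 2 - I * x) / 2‖ * ((n : ℝ) + 1 / 4)))
      ≤ 1 * (|x| / 2 / (((n : ℝ) + 1 / 4) * ((n : ℝ) + 1 / 4))) := by
        gcongr
    _ = |x| / 2 * (1 / ((n : ℝ) + 1 / 4) ^ 2) := by rw [pow_two]; ring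

/-- The `n`-th term of the bracket is also at most `8 e^{−2|t|n}` uniformly in `x`. [folklore] -/
private theorem norm_lerchTerm_le_geom (t x : ℝ) (n : ℕ) :
    ‖(Real.exp (-(2 * |t| * n)) : ℂ) *
        (1 / ((n : ℂ) + (1 / 2 - I * x) / 2) - 1 / ((n : ℂ) + 1 / 4))‖ ≤
      8 * Real.exp (-(2 * |t|)) ^ n := by
  have hk : (0 : ℝ) ≤ n := n.cast_nonneg
  have hexp : ‖(Real.exp (-(2 * |t| * n)) : ℂ)‖ = Real.exp (-(2 * |t|)) ^ n := by
    rw [Complex.norm_real, Real.norm_eq_abs, abs_of_pos (Real.exp_pos _), ← Real.exp_nat_mul]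
    congr 1; ring
  have hq' : ‖(n : ℂ) + 1 / 4‖ = (n : ℝ) + 1 / 4 := by
    have : ((n : ℂ) + 1 / 4) = (((n : ℝ) + 1 / 4 : ℝ) : ℂ) := by push_cast; ring
    rw [this, Complex.norm_real, Real.norm_eq_abs, abs_of_pos (by positivity)]
  have hw' : (n : ℝ) + 1 / 4 ≤ ‖(n : ℂ) + (1 / 2 - I * x) / 2‖ := by
    have := Complex.abs_re_le_norm ((n : ℂ) + (1 / 2 - I * x) / 2)
    simp at this
    rw [abs_of_pos (by positivity)] at this
    linarith
  have h1 : ‖1 / ((n : ℂ) + (1 / 2 - I * x) / 2)‖ ≤ 4 := by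
    rw [norm_div, norm_one]
    rw [div_le_iff₀ (lt_of_lt_of_le (by positivity) hw')]
    nlinarith
  have h2 : ‖1 / ((n : ℂ) + 1 / 4)‖ ≤ 4 := by
    rw [norm_div, norm_one, hq', div_le_iff₀ (by positivity)]
    nlinarith
  rw [norm_mul, hexp, mul_comm]
  gcongr
  exact (norm_sub_le _ _).trans (by linarith)

/-- The terms of the bracket are summable (for every `t`, `x`). [folklore] -/
private theorem summable_lerchTerms (t x : ℝ) :
    Summable (fun n : ℕ ↦ (Real.exp (-(2 * |t| * n)) : ℂ) *
        (1 / ((n : ℂ) + (1 / 2 - I * x) / 2) - 1 / ((n : ℂ) + 1 / 4))) :=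
  Summable.of_norm_bounded (summable_quarterSq.mul_left (|x| / 2)) (norm_lerchTerm_le t x)

/-- `‖B(t,x)‖ ≤ S|x|/2` (all `t`, `x`). [folklore] -/
private theorem norm_screwLerchBracket_le (t x : ℝ) :
    ‖screwLerchBracket t x‖ ≤ |x| / 2 * (∑' n : ℕ, 1 / ((n : ℝ) + 1 / 4) ^ 2) :=
  tsum_of_norm_bounded (summable_quarterSq.hasSum.mul_left (|x| / 2)) (norm_lerchTerm_le t x)

/-- `‖B(t,x)‖ ≤ 8/(1 − e^{−2|t|})` for `t ≠ 0` (all `x`). [folklore] -/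
private theorem norm_screwLerchBracket_le_const {t : ℝ} (ht : t ≠ 0) (x : ℝ) :
    ‖screwLerchBracket t x‖ ≤ 8 * (1 - Real.exp (-(2 * |t|)))⁻¹ := by
  have hr0 : 0 ≤ Real.exp (-(2 * |t|)) := (Real.exp_pos _).le
  have hr1 : Real.exp (-(2 * |t|)) < 1 := by
    rw [Real.exp_lt_one_iff]; have := abs_pos.2 ht; linarith
  have hg := (hasSum_geometric_of_lt_one hr0 hr1).mul_left 8
  exact tsum_of_norm_bounded hg (norm_lerchTerm_le_geom t x)

/-! ## The prime sum of (1.6) -/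

/-- `‖Σ_{n≤e^{|t|}} Λ(n)n^{-1/2}(e^{−ix(|t|−log n)}−1)/(ix)‖ ≤ (Σ Λ(n)n^{-1/2})(2|t|+4)/(1+|x|)`. [folklore] -/
private theorem norm_primeTerm_le (t x : ℝ) :
    ‖∑ n ∈ Finset.Icc 1 ⌊Real.exp |t|⌋₊,
        ((ArithmeticFunction.vonMangoldt n / Real.sqrt n : ℝ) : ℂ) *
          ((cexp (-(I * x * ((|t| - Real.log n : ℝ) : ℂ))) - 1) / (I * x))‖ ≤
      (∑ n ∈ Finset.Icc 1 ⌊Real.exp |t|⌋₊, ArithmeticFunction.vonMangoldt n / Real.sqrt n) *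
        ((2 * |t| + 4) / (1 + |x|)) := by
  rw [Finset.sum_mul]
  refine (norm_sum_le _ _).trans (Finset.sum_le_sum fun n hn ↦ ?_)
  rw [Finset.mem_Icc] at hn
  have hn1 : (1 : ℝ) ≤ n := by exact_mod_cast hn.1
  have hnpos : (0 : ℝ) < n := by linarith
  have hlog0 : 0 ≤ Real.log n := Real.log_nonneg hn1
  have hlogt : Real.log n ≤ |t| := by
    have h1 : (n : ℝ) ≤ ⌊Real.exp |t|⌋₊ := by exact_mod_cast hn.2
    have h2 : (⌊Real.exp |t|⌋₊ : ℝ) ≤ Real.exp |t| := Nat.floor_le (Real.exp_pos _).le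
    rw [Real.log_le_iff_le_exp hnpos]; linarith
  have hc : 0 ≤ ArithmeticFunction.vonMangoldt n / Real.sqrt n :=
    div_nonneg ArithmeticFunction.vonMangoldt_nonneg (Real.sqrt_nonneg _)
  rw [norm_mul, Complex.norm_real, Real.norm_eq_abs, abs_of_nonneg hc]
  gcongr
  have h := norm_expFactor_le x (u := |t| - Real.log n) (a := |t|) (by linarith) (by linarith)
  have e : ((|t| - Real.log n : ℝ) : ℂ) = ((|t| - Real.log n : ℝ) : ℂ) := rfl
  simpa using h

/-! ## The global pointwise bound -/

/-- (1.5)–(1.6) at a real point, definitional unfolding. [cite: Suzuki2025WeilHilbertSpace, eqs. (1.5)–(1.6)] -/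
theorem screwLine_ofReal_eq (t x : ℝ) :
    screwLine t x = I * (1 + sharp lagariasTheta x) / 2 *
      (4 * ((Real.exp (|t| / 2) - 1 : ℝ) : ℂ) / (1 + 2 * I * x) +
        4 * ((Real.exp (-(|t| / 2)) - 1 : ℝ) : ℂ) / (1 - 2 * I * x) +
        (cexp (-(I * x * (|t| : ℝ))) - 1) / (I * x) *
          (deriv riemannZeta (1 / 2 - I * x) / riemannZeta (1 / 2 - I * x)) +
        (∑ n ∈ Finset.Icc 1 ⌊Real.exp |t|⌋₊,
          ((ArithmeticFunction.vonMangoldt n / Real.sqrt n : ℝ) : ℂ) *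
            ((cexp (-(I * x * ((|t| - Real.log n : ℝ) : ℂ))) - 1) / (I * x))) -
        1 / (2 * I * x) * (Complex.digamma (1 / 4 - I * x / 2) - Complex.digamma (1 / 4)) -
        1 / (2 * I * x) * ((Real.exp (-(|t| / 2)) : ℝ) : ℂ) * screwLerchBracket t x) := rfl

/-- `‖i(1 + Θ♯(x))/2‖ ≤ 1` on the real line. [folklore] -/
private theorem norm_thetaFactor_le (x : ℝ) : ‖I * (1 + sharp lagariasTheta x) / 2‖ ≤ 1 := by
  rw [norm_div, norm_mul, Complex.norm_I, one_mul, Complex.norm_two, sharp_ofReal]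
  have h : ‖1 + (starRingEnd ℂ) (lagariasTheta x)‖ ≤ 2 := by
    refine (norm_add_le _ _).trans ?_
    rw [norm_one, Complex.norm_conj]
    linarith [norm_lagariasTheta_ofReal_le_one x]
  linarith

/-- `‖(i(1+Θ♯(x))/2) · ζ′/ζ(½−ix)‖ ≤ 6 + ½‖ψ(¼ − ix/2)‖` for every real `x`: the cancellation
`|(1+Θ♯)ξ′/ξ| ≤ 2`, `ζ′/ζ = ξ′/ξ − 1/s − 1/(s−1) − Γ_ℝ′/Γ_ℝ`, `|1/s|,|1/(s−1)| ≤ 2`,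
`|Γ_ℝ′/Γ_ℝ(s)| ≤ 1 + ½|ψ(s/2)|` (and the junk value `0` if `ζ(s) = 0`).
[cite: Suzuki2025WeilHilbertSpace, §3.2 (TeX l.989–1008)] -/
theorem norm_thetaFactor_mul_logDeriv_zeta_le (x : ℝ) :
    ‖I * (1 + sharp lagariasTheta x) / 2 *
        (deriv riemannZeta (1 / 2 - I * x) / riemannZeta (1 / 2 - I * x))‖ ≤
      6 + ‖Complex.digamma (1 / 4 - I * x / 2)‖ / 2 := by
  have hψ := norm_nonneg (Complex.digamma (1 / 4 - I * x / 2))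
  by_cases hζ : riemannZeta (1 / 2 - I * x) = 0
  · rw [hζ, div_zero, mul_zero, norm_zero]; linarith
  rw [logDeriv_zeta_critical_eq hζ]
  have hc := norm_thetaFactor_le x
  have h2 : ‖(1 + sharp lagariasTheta x)‖ ≤ 2 := by
    rw [sharp_ofReal]
    refine (norm_add_le _ _).trans ?_
    rw [norm_one, Complex.norm_conj]
    linarith [norm_lagariasTheta_ofReal_le_one x]
  have hcan := norm_one_add_sharp_theta_mul_logDeriv_xi_le x
  obtain ⟨hs, hs1⟩ := norm_inv_critical_le x
  have hG := norm_logDeriv_Gammaℝ_critical_le x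
  -- split `c * (L − a − b − G) = (I/2) * ((1+Θ♯) L) − c * (a + b + G)`
  have hsplit : I * (1 + sharp lagariasTheta x) / 2 *
      (logDeriv riemannXi (1 / 2 - I * x) - (1 / 2 - I * x : ℂ)⁻¹ -
        ((1 / 2 - I * x : ℂ) - 1)⁻¹ - logDeriv Gammaℝ (1 / 2 - I * x)) =
      I / 2 * ((1 + sharp lagariasTheta x) * logDeriv riemannXi (1 / 2 - I * x)) -
        I * (1 + sharp lagariasTheta x) / 2 *
          ((1 / 2 - I * x : ℂ)⁻¹ + ((1 / 2 - I * x : ℂ) - 1)⁻¹ + logDeriv Gammaℝ (1 / 2 - I * x)) := by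
    ring
  rw [hsplit]
  refine (norm_sub_le _ _).trans ?_
  have hA : ‖I / 2 * ((1 + sharp lagariasTheta x) * logDeriv riemannXi (1 / 2 - I * x))‖ ≤ 1 := by
    rw [norm_mul, norm_div, Complex.norm_I, Complex.norm_two]; linarith
  have hB : ‖I * (1 + sharp lagariasTheta x) / 2 *
      ((1 / 2 - I * x : ℂ)⁻¹ + ((1 / 2 - I * x : ℂ) - 1)⁻¹ + logDeriv Gammaℝ (1 / 2 - I * x))‖ ≤
      5 + ‖Complex.digamma (1 / 4 - I * x / 2)‖ / 2 := by
    rw [norm_mul]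
    have hsum : ‖(1 / 2 - I * x : ℂ)⁻¹ + ((1 / 2 - I * x : ℂ) - 1)⁻¹ + logDeriv Gammaℝ (1 / 2 - I * x)‖ ≤
        5 + ‖Complex.digamma (1 / 4 - I * x / 2)‖ / 2 := by
      refine (norm_add_le _ _).trans ?_
      have := norm_add_le ((1 / 2 - I * x : ℂ)⁻¹) (((1 / 2 - I * x : ℂ) - 1)⁻¹)
      linarith
    calc ‖I * (1 + sharp lagariasTheta x) / 2‖ *
        ‖(1 / 2 - I * x : ℂ)⁻¹ + ((1 / 2 - I * x : ℂ) - 1)⁻¹ + logDeriv Gammaℝ (1 / 2 - I * x)‖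
        ≤ 1 * (5 + ‖Complex.digamma (1 / 4 - I * x / 2)‖ / 2) := by gcongr
      _ = _ := one_mul _
  linarith

/-- **Global pointwise bound** (the heart of CJM Prop 1.2, RH-free): for `t ≠ 0` there is `K` with
`‖𝔖_t(x)‖ ≤ K (1 + log(2+|x|))/(1+|x|)` for EVERY real `x`.
[cite: Suzuki2025WeilHilbertSpace, §3.2 (TeX l.985–1015)] -/
theorem norm_screwLine_le_log {t : ℝ} (ht : t ≠ 0) :
    ∃ K : ℝ, 0 ≤ K ∧ ∀ x : ℝ,
      ‖screwLine t x‖ ≤ K * ((1 + Real.log (2 + |x|)) / (1 + |x|)) := by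
  set a : ℝ := |t| with ha
  have ha0 : 0 < a := abs_pos.2 ht
  set S : ℝ := (∑' n : ℕ, 1 / ((n : ℝ) + 1 / 4) ^ 2)
  have hS : 0 ≤ S := quarterSqSum_nonneg
  set M₁ : ℝ := ‖Complex.digamma (1 / 4)‖ + S / 2 + 8 with hM₁
  have hM₁ : 0 ≤ M₁ := by positivity
  set C₄ : ℝ := ∑ n ∈ Finset.Icc 1 ⌊Real.exp |t|⌋₊, ArithmeticFunction.vonMangoldt n / Real.sqrt n
  have hC₄ : 0 ≤ C₄ := Finset.sum_nonneg fun n _ ↦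
    div_nonneg ArithmeticFunction.vonMangoldt_nonneg (Real.sqrt_nonneg _)
  set G : ℝ := (1 - Real.exp (-(2 * |t|)))⁻¹ with hG
  have hG0 : 0 ≤ G := by
    rw [hG, inv_nonneg, sub_nonneg, Real.exp_le_one_iff]; have := abs_nonneg t; linarith
  -- the constant
  refine ⟨8 * |Real.exp (a / 2) - 1| + 8 * |Real.exp (-(a / 2)) - 1| + C₄ * (2 * a + 4) +
      (S / 2 + M₁ + ‖Complex.digamma (1 / 4)‖ + 1) + (S / 2 + 8 * G) +
      ((2 * a + 4) * (6 + M₁ / 2) + (a + 2)), by positivity, fun x ↦ ?_⟩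
  set D : ℝ := 1 + |x| with hD
  have hD0 : 0 < D := by positivity
  have hD1 : 1 ≤ D := by rw [hD]; linarith [abs_nonneg x]
  set L : ℝ := Real.log (2 + |x|) with hL
  have hL0 : 0 ≤ L := Real.log_nonneg (by linarith [abs_nonneg x])
  set Q : ℝ := (1 + L) / D with hQ
  have hQ0 : 0 ≤ Q := by positivity
  have h1D : 1 / D ≤ Q := by rw [hQ]; gcongr; linarith
  have hLD : L / D ≤ Q := by rw [hQ]; gcongr; linarith
  -- digamma on the line
  have hψ : ‖Complex.digamma (1 / 4 - I * x / 2)‖ ≤ M₁ + L := norm_digamma_quarter_line_le x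
  -- the six bounds
  have hT1 : ‖4 * ((Real.exp (|t| / 2) - 1 : ℝ) : ℂ) / (1 + 2 * I * x)‖ ≤
      8 * |Real.exp (a / 2) - 1| * Q := by
    have h := norm_div_one_add_le (4 * ((Real.exp (|t| / 2) - 1 : ℝ) : ℂ)) x 1 (Or.inl rfl)
    have e : ((1 : ℝ) : ℂ) * (2 * I * x) = 2 * I * x := by push_cast; ring
    rw [e] at h
    refine h.trans ?_
    rw [norm_mul, Complex.norm_real, Real.norm_eq_abs, show ‖(4 : ℂ)‖ = 4 by simp]
    calc 2 * (4 * |Real.exp (|t| / 2) - 1|) / (1 + |x|) = 8 * |Real.exp (a / 2) - 1| * (1 / D) := by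
          rw [ha, hD]; ring
      _ ≤ 8 * |Real.exp (a / 2) - 1| * Q := by gcongr
  have hT2 : ‖4 * ((Real.exp (-(|t| / 2)) - 1 : ℝ) : ℂ) / (1 - 2 * I * x)‖ ≤
      8 * |Real.exp (-(a / 2)) - 1| * Q := by
    have h := norm_div_one_add_le (4 * ((Real.exp (-(|t| / 2)) - 1 : ℝ) : ℂ)) x (-1) (Or.inr rfl)
    have e : (1 : ℂ) + ((-1 : ℝ) : ℂ) * (2 * I * x) = 1 - 2 * I * x := by push_cast; ring
    rw [e] at h
    refine h.trans ?_
    rw [norm_mul, Complex.norm_real, Real.norm_eq_abs, show ‖(4 : ℂ)‖ = 4 by simp]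
    calc 2 * (4 * |Real.exp (-(|t| / 2)) - 1|) / (1 + |x|) =
        8 * |Real.exp (-(a / 2)) - 1| * (1 / D) := by rw [ha, hD]; ring
      _ ≤ 8 * |Real.exp (-(a / 2)) - 1| * Q := by gcongr
  have hT3 : ‖(cexp (-(I * x * (|t| : ℝ))) - 1) / (I * x) *
      (I * (1 + sharp lagariasTheta x) / 2 *
        (deriv riemannZeta (1 / 2 - I * x) / riemannZeta (1 / 2 - I * x)))‖ ≤
      (2 * a + 4) * (6 + M₁ / 2) * Q + (a + 2) * Q := by
    rw [norm_mul]
    have hP := norm_expFactor_le x (u := |t|) (a := a) (abs_nonneg t) (by rw [ha])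
    have hZ := norm_thetaFactor_mul_logDeriv_zeta_le x
    calc ‖(cexp (-(I * x * (|t| : ℝ))) - 1) / (I * x)‖ *
        ‖I * (1 + sharp lagariasTheta x) / 2 *
          (deriv riemannZeta (1 / 2 - I * x) / riemannZeta (1 / 2 - I * x))‖
        ≤ ((2 * a + 4) / (1 + |x|)) * (6 + ‖Complex.digamma (1 / 4 - I * x / 2)‖ / 2) := by
          gcongr
      _ ≤ ((2 * a + 4) / D) * (6 + (M₁ + L) / 2) := by rw [hD]; gcongr
      _ = (2 * a + 4) * (6 + M₁ / 2) * (1 / D) + (a + 2) * (L / D) := by ring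
      _ ≤ (2 * a + 4) * (6 + M₁ / 2) * Q + (a + 2) * Q := by gcongr
  have hT4 : ‖∑ n ∈ Finset.Icc 1 ⌊Real.exp |t|⌋₊,
      ((ArithmeticFunction.vonMangoldt n / Real.sqrt n : ℝ) : ℂ) *
        ((cexp (-(I * x * ((|t| - Real.log n : ℝ) : ℂ))) - 1) / (I * x))‖ ≤ C₄ * (2 * a + 4) * Q := by
    refine (norm_primeTerm_le t x).trans ?_
    rw [← ha, ← hD]
    calc C₄ * ((2 * a + 4) / D) = C₄ * (2 * a + 4) * (1 / D) := by ring
      _ ≤ C₄ * (2 * a + 4) * Q := by gcongr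
  have hQhalf : |x| ≤ 1 → 1 / 2 ≤ Q := fun hx ↦ by
    have : 1 / 2 ≤ 1 / D := by
      rw [hD, div_le_div_iff₀ (by norm_num) hD0]; linarith
    exact this.trans h1D
  have hDx : 1 < |x| → 1 / (2 * |x|) ≤ 1 / D := fun hx ↦ by
    rw [hD]; gcongr; linarith
  have hψq := norm_nonneg (Complex.digamma (1 / 4))
  have hT5 : ‖1 / (2 * I * x) * (Complex.digamma (1 / 4 - I * x / 2) - Complex.digamma (1 / 4))‖ ≤
      (S / 2 + M₁ + ‖Complex.digamma (1 / 4)‖ + 1) * Q := by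
    by_cases hx0 : x = 0
    · have : (1 : ℂ) / (2 * I * ((0 : ℝ) : ℂ)) = 0 := by simp
      rw [hx0, this, zero_mul, norm_zero]; positivity
    have hxpos : 0 < |x| := abs_pos.2 hx0
    have hn : ‖1 / (2 * I * (x : ℂ))‖ = 1 / (2 * |x|) := by
      rw [norm_div, norm_one, norm_mul, norm_mul, Complex.norm_two, Complex.norm_I, mul_one,
        Complex.norm_real, Real.norm_eq_abs]
    rw [norm_mul, hn]
    rcases le_or_gt |x| 1 with hx | hx
    · have h := norm_digamma_sub_quarter_le x
      have hq := hQhalf hx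
      calc 1 / (2 * |x|) * ‖Complex.digamma (1 / 4 - I * x / 2) - Complex.digamma (1 / 4)‖
          ≤ 1 / (2 * |x|) * (S * (|x| / 2)) := by gcongr
        _ = (S / 2) * (1 / 2) := by field_simp
        _ ≤ (S / 2) * Q := by gcongr
        _ ≤ (S / 2 + M₁ + ‖Complex.digamma (1 / 4)‖ + 1) * Q := by gcongr; linarith
    · have h : ‖Complex.digamma (1 / 4 - I * x / 2) - Complex.digamma (1 / 4)‖ ≤
          (M₁ + ‖Complex.digamma (1 / 4)‖) + L := (norm_sub_le _ _).trans (by linarith)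
      have hd := hDx hx
      have e1 : (M₁ + ‖Complex.digamma (1 / 4)‖) * (1 / D) ≤ (M₁ + ‖Complex.digamma (1 / 4)‖) * Q :=
        mul_le_mul_of_nonneg_left h1D (by positivity)
      calc 1 / (2 * |x|) * ‖Complex.digamma (1 / 4 - I * x / 2) - Complex.digamma (1 / 4)‖
          ≤ 1 / D * ((M₁ + ‖Complex.digamma (1 / 4)‖) + L) := by gcongr
        _ = (M₁ + ‖Complex.digamma (1 / 4)‖) * (1 / D) + L / D := by ring
        _ ≤ (M₁ + ‖Complex.digamma (1 / 4)‖) * Q + Q := add_le_add e1 hLD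
        _ = (M₁ + ‖Complex.digamma (1 / 4)‖ + 1) * Q := by ring
        _ ≤ (S / 2 + M₁ + ‖Complex.digamma (1 / 4)‖ + 1) * Q := by gcongr; linarith
  have hT6 : ‖1 / (2 * I * x) * ((Real.exp (-(|t| / 2)) : ℝ) : ℂ) * screwLerchBracket t x‖ ≤
      (S / 2 + 8 * G) * Q := by
    by_cases hx0 : x = 0
    · have : (1 : ℂ) / (2 * I * ((0 : ℝ) : ℂ)) = 0 := by simp
      rw [hx0, this, zero_mul, zero_mul, norm_zero]; positivity
    have hxpos : 0 < |x| := abs_pos.2 hx0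
    have hn : ‖1 / (2 * I * (x : ℂ))‖ = 1 / (2 * |x|) := by
      rw [norm_div, norm_one, norm_mul, norm_mul, Complex.norm_two, Complex.norm_I, mul_one,
        Complex.norm_real, Real.norm_eq_abs]
    have he : ‖((Real.exp (-(|t| / 2)) : ℝ) : ℂ)‖ ≤ 1 := by
      rw [Complex.norm_real, Real.norm_eq_abs, abs_of_pos (Real.exp_pos _), Real.exp_le_one_iff]
      linarith [abs_nonneg t]
    have h8G : 0 ≤ 8 * G := by positivity
    rw [norm_mul, norm_mul, hn]
    rcases le_or_gt |x| 1 with hx | hx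
    · have h := norm_screwLerchBracket_le t x
      have hq := hQhalf hx
      calc 1 / (2 * |x|) * ‖((Real.exp (-(|t| / 2)) : ℝ) : ℂ)‖ * ‖screwLerchBracket t x‖
          ≤ 1 / (2 * |x|) * 1 * (|x| / 2 * S) := by gcongr
        _ = (S / 2) * (1 / 2) := by field_simp
        _ ≤ (S / 2) * Q := by gcongr
        _ ≤ (S / 2 + 8 * G) * Q := by gcongr; linarith
    · have h := norm_screwLerchBracket_le_const ht x
      have hd := hDx hx
      have e1 : (8 * G) * (1 / D) ≤ (8 * G) * Q := mul_le_mul_of_nonneg_left h1D h8G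
      calc 1 / (2 * |x|) * ‖((Real.exp (-(|t| / 2)) : ℝ) : ℂ)‖ * ‖screwLerchBracket t x‖
          ≤ 1 / D * 1 * (8 * G) := by gcongr
        _ = (8 * G) * (1 / D) := by ring
        _ ≤ (8 * G) * Q := e1
        _ ≤ (S / 2 + 8 * G) * Q := by gcongr; linarith
  -- assemble
  rw [screwLine_ofReal_eq]
  set c := I * (1 + sharp lagariasTheta (x : ℂ)) / 2 with hc
  have hcn : ‖c‖ ≤ 1 := norm_thetaFactor_le x
  set T1 := 4 * ((Real.exp (|t| / 2) - 1 : ℝ) : ℂ) / (1 + 2 * I * x) with hT1d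
  set T2 := 4 * ((Real.exp (-(|t| / 2)) - 1 : ℝ) : ℂ) / (1 - 2 * I * x) with hT2d
  set P := (cexp (-(I * x * (|t| : ℝ))) - 1) / (I * x) with hPd
  set Z := deriv riemannZeta (1 / 2 - I * x) / riemannZeta (1 / 2 - I * x) with hZd
  set T4 := ∑ n ∈ Finset.Icc 1 ⌊Real.exp |t|⌋₊,
      ((ArithmeticFunction.vonMangoldt n / Real.sqrt n : ℝ) : ℂ) *
        ((cexp (-(I * x * ((|t| - Real.log n : ℝ) : ℂ))) - 1) / (I * x)) with hT4d
  set T5 := 1 / (2 * I * x) * (Complex.digamma (1 / 4 - I * x / 2) - Complex.digamma (1 / 4)) with hT5d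
  set T6 := 1 / (2 * I * x) * ((Real.exp (-(|t| / 2)) : ℝ) : ℂ) * screwLerchBracket t x with hT6d
  have hsplit : c * (T1 + T2 + P * Z + T4 - T5 - T6) = c * (T1 + T2 + T4 - T5 - T6) + P * (c * Z) := by
    ring
  rw [hsplit]
  have hrest : ‖c * (T1 + T2 + T4 - T5 - T6)‖ ≤ ‖T1‖ + ‖T2‖ + ‖T4‖ + ‖T5‖ + ‖T6‖ := by
    rw [norm_mul]
    have h : ‖T1 + T2 + T4 - T5 - T6‖ ≤ ‖T1‖ + ‖T2‖ + ‖T4‖ + ‖T5‖ + ‖T6‖ := by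
      have h1 := norm_sub_le (T1 + T2 + T4 - T5) T6
      have h2 := norm_sub_le (T1 + T2 + T4) T5
      have h3 := norm_add_le (T1 + T2) T4
      have h4 := norm_add_le T1 T2
      linarith
    calc ‖c‖ * ‖T1 + T2 + T4 - T5 - T6‖ ≤ 1 * (‖T1‖ + ‖T2‖ + ‖T4‖ + ‖T5‖ + ‖T6‖) := by
          gcongr
      _ = _ := one_mul _
  have hPZ : ‖P * (c * Z)‖ ≤ (2 * a + 4) * (6 + M₁ / 2) * Q + (a + 2) * Q := by
    rw [hPd, hc, hZd]; exact hT3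
  calc ‖c * (T1 + T2 + T4 - T5 - T6) + P * (c * Z)‖
      ≤ ‖c * (T1 + T2 + T4 - T5 - T6)‖ + ‖P * (c * Z)‖ := norm_add_le _ _
    _ ≤ (‖T1‖ + ‖T2‖ + ‖T4‖ + ‖T5‖ + ‖T6‖) + ((2 * a + 4) * (6 + M₁ / 2) * Q + (a + 2) * Q) :=
        add_le_add hrest hPZ
    _ ≤ (8 * |Real.exp (a / 2) - 1| * Q + 8 * |Real.exp (-(a / 2)) - 1| * Q + C₄ * (2 * a + 4) * Q +
          (S / 2 + M₁ + ‖Complex.digamma (1 / 4)‖ + 1) * Q + (S / 2 + 8 * G) * Q) +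
          ((2 * a + 4) * (6 + M₁ / 2) * Q + (a + 2) * Q) := by
        gcongr
    _ = _ := by ring

/-! ## Measurability -/

/-- `x ↦ B(t,x)` is continuous for `t ≠ 0` (uniformly convergent series). [folklore] -/
private theorem continuous_screwLerchBracket {t : ℝ} (ht : t ≠ 0) :
    Continuous fun x : ℝ ↦ screwLerchBracket t x := by
  have hr0 : 0 ≤ Real.exp (-(2 * |t|)) := (Real.exp_pos _).le
  have hr1 : Real.exp (-(2 * |t|)) < 1 := by
    rw [Real.exp_lt_one_iff]; have := abs_pos.2 ht; linarith
  have hsum : Summable (fun n : ℕ ↦ 8 * Real.exp (-(2 * |t|)) ^ n) :=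
    (summable_geometric_of_lt_one hr0 hr1).mul_left 8
  unfold screwLerchBracket
  refine continuous_tsum (fun n ↦ ?_) hsum (fun n x ↦ norm_lerchTerm_le_geom t x n)
  have hne : ∀ x : ℝ, ((n : ℂ) + (1 / 2 - I * x) / 2) ≠ 0 := fun x h ↦ by
    have := congrArg Complex.re h
    simp at this
    linarith [n.cast_nonneg (α := ℝ)]
  exact continuous_const.mul
    ((continuous_const.div (by fun_prop) hne).sub continuous_const)

/-- `x ↦ ψ(¼ − ix/2)` is continuous. [folklore] -/
private theorem continuous_digamma_quarter_line :
    Continuous fun x : ℝ ↦ Complex.digamma (1 / 4 - I * x / 2) := by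
  refine continuous_iff_continuousAt.2 fun x ↦ ?_
  have h : ContinuousAt Complex.digamma (1 / 4 - I * x / 2) :=
    continuousAt_digamma_of_re_pos (by simp)
  exact ContinuousAt.comp (g := Complex.digamma) h
    (by fun_prop : Continuous fun x : ℝ ↦ (1 / 4 : ℂ) - I * x / 2).continuousAt

/-- `ζ` is Borel measurable (continuous off `s = 1`). [folklore] -/
private theorem measurable_riemannZeta : Measurable riemannZeta :=
  measurable_of_continuousOn_compl_singleton 1
    (fun _ hs ↦ (differentiableAt_riemannZeta hs).continuousAt.continuousWithinAt)

/-- `x ↦ 𝔖_t(x)` is measurable on `ℝ` (`t ≠ 0`). [folklore] -/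
private theorem measurable_screwLine {t : ℝ} (ht : t ≠ 0) : Measurable fun x : ℝ ↦ screwLine t x := by
  have hofReal : Measurable (fun x : ℝ ↦ (x : ℂ)) := Complex.measurable_ofReal
  have ms : Measurable fun x : ℝ ↦ (1 / 2 : ℂ) - I * x := by fun_prop
  have mζ : Measurable fun x : ℝ ↦ riemannZeta (1 / 2 - I * x) := measurable_riemannZeta.comp ms
  have mζ' : Measurable fun x : ℝ ↦ deriv riemannZeta (1 / 2 - I * x) :=
    (measurable_deriv riemannZeta).comp ms
  have mψ : Measurable fun x : ℝ ↦ Complex.digamma (1 / 4 - I * x / 2) :=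
    continuous_digamma_quarter_line.measurable
  have mΘ : Measurable fun x : ℝ ↦ sharp lagariasTheta x := by
    have : (fun x : ℝ ↦ sharp lagariasTheta x) = fun x : ℝ ↦ (starRingEnd ℂ) (lagariasTheta x) :=
      funext fun x ↦ sharp_ofReal _ _
    rw [this]
    exact Complex.continuous_conj.measurable.comp (measurable_lagariasTheta.comp hofReal)
  have mB : Measurable fun x : ℝ ↦ screwLerchBracket t x := (continuous_screwLerchBracket ht).measurable
  have mIx : Measurable fun x : ℝ ↦ I * (x : ℂ) := by fun_prop
  have mexp : ∀ u : ℝ, Measurable fun x : ℝ ↦ (cexp (-(I * x * u)) - 1) / (I * x) := fun u ↦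
    ((Complex.measurable_exp.comp (by fun_prop)).sub measurable_const).div mIx
  have hfun : (fun x : ℝ ↦ screwLine t x) = fun x : ℝ ↦ I * (1 + sharp lagariasTheta x) / 2 *
      (4 * ((Real.exp (|t| / 2) - 1 : ℝ) : ℂ) / (1 + 2 * I * x) +
        4 * ((Real.exp (-(|t| / 2)) - 1 : ℝ) : ℂ) / (1 - 2 * I * x) +
        (cexp (-(I * x * (|t| : ℝ))) - 1) / (I * x) *
          (deriv riemannZeta (1 / 2 - I * x) / riemannZeta (1 / 2 - I * x)) +
        (∑ n ∈ Finset.Icc 1 ⌊Real.exp |t|⌋₊,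
          ((ArithmeticFunction.vonMangoldt n / Real.sqrt n : ℝ) : ℂ) *
            ((cexp (-(I * x * ((|t| - Real.log n : ℝ) : ℂ))) - 1) / (I * x))) -
        1 / (2 * I * x) * (Complex.digamma (1 / 4 - I * x / 2) - Complex.digamma (1 / 4)) -
        1 / (2 * I * x) * ((Real.exp (-(|t| / 2)) : ℝ) : ℂ) * screwLerchBracket t x) :=
    funext fun x ↦ screwLine_ofReal_eq t x
  rw [hfun]
  have m1 : Measurable fun x : ℝ ↦ I * (1 + sharp lagariasTheta x) / 2 :=
    ((measurable_const.mul (measurable_const.add mΘ)).div measurable_const)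
  have mT1 : Measurable fun x : ℝ ↦ 4 * ((Real.exp (|t| / 2) - 1 : ℝ) : ℂ) / (1 + 2 * I * x) :=
    measurable_const.div (by fun_prop)
  have mT2 : Measurable fun x : ℝ ↦ 4 * ((Real.exp (-(|t| / 2)) - 1 : ℝ) : ℂ) / (1 - 2 * I * x) :=
    measurable_const.div (by fun_prop)
  have mT3 : Measurable fun x : ℝ ↦ (cexp (-(I * x * (|t| : ℝ))) - 1) / (I * x) *
      (deriv riemannZeta (1 / 2 - I * x) / riemannZeta (1 / 2 - I * x)) :=
    (mexp |t|).mul (mζ'.div mζ)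
  have mT4 : Measurable fun x : ℝ ↦ ∑ n ∈ Finset.Icc 1 ⌊Real.exp |t|⌋₊,
      ((ArithmeticFunction.vonMangoldt n / Real.sqrt n : ℝ) : ℂ) *
        ((cexp (-(I * x * ((|t| - Real.log n : ℝ) : ℂ))) - 1) / (I * x)) :=
    Finset.measurable_sum _ fun n _ ↦ measurable_const.mul (mexp _)
  have m2Ix : Measurable fun x : ℝ ↦ 1 / (2 * I * (x : ℂ)) := measurable_const.div (by fun_prop)
  have mT5 : Measurable fun x : ℝ ↦
      1 / (2 * I * x) * (Complex.digamma (1 / 4 - I * x / 2) - Complex.digamma (1 / 4)) :=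
    m2Ix.mul (mψ.sub measurable_const)
  have mT6 : Measurable fun x : ℝ ↦
      1 / (2 * I * x) * ((Real.exp (-(|t| / 2)) : ℝ) : ℂ) * screwLerchBracket t x :=
    (m2Ix.mul measurable_const).mul mB
  exact m1.mul (((((mT1.add mT2).add mT3).add mT4).sub mT5).sub mT6)

/-! ## Square integrability -/

/-- From the logarithmic bound to a power majorant:
`(1 + log(2+|x|))/(1+|x|) ≤ 6 (1+|x|)^{-3/4}`. [folklore] -/
private theorem one_add_log_div_le (x : ℝ) :
    (1 + Real.log (2 + |x|)) / (1 + |x|) ≤ 6 * (1 + |x|) ^ (-(3 / 4 : ℝ)) := by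
  have hD : 0 < 1 + |x| := by positivity
  have hD1 : 1 ≤ 1 + |x| := by linarith [abs_nonneg x]
  have hlog : Real.log (2 + |x|) ≤ 1 + 4 * (1 + |x|) ^ (1 / 4 : ℝ) := by
    have h1 : Real.log (2 + |x|) ≤ Real.log 2 + Real.log (1 + |x|) := by
      rw [← Real.log_mul (by norm_num) hD.ne']
      exact Real.log_le_log (by positivity) (by linarith)
    have h2 : Real.log (1 + |x|) ≤ (1 + |x|) ^ (1 / 4 : ℝ) / (1 / 4) :=
      Real.log_le_rpow_div hD.le (by norm_num)
    have h3 : Real.log 2 < 1 := by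
      have := Real.log_two_lt_d9; norm_num at this; linarith
    linarith
  have hr : (1 : ℝ) ≤ (1 + |x|) ^ (1 / 4 : ℝ) := Real.one_le_rpow hD1 (by norm_num)
  have e : (1 + |x|) ^ (-(3 / 4 : ℝ)) = (1 + |x|) ^ (1 / 4 : ℝ) / (1 + |x|) := by
    rw [show (-(3 / 4 : ℝ)) = 1 / 4 - 1 by norm_num, Real.rpow_sub hD, Real.rpow_one]
  rw [e, show 6 * ((1 + |x|) ^ (1 / 4 : ℝ) / (1 + |x|)) = (6 * (1 + |x|) ^ (1 / 4 : ℝ)) / (1 + |x|)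
    by ring]
  gcongr
  linarith

/-- The majorant `(1+|x|)^{-3/4}` is in `L²(ℝ)`. [folklore] -/
private theorem memLp_two_rpow_majorant : MemLp (fun x : ℝ ↦ (1 + |x|) ^ (-(3 / 4 : ℝ))) 2 volume := by
  have hmeas : AEStronglyMeasurable (fun x : ℝ ↦ (1 + |x|) ^ (-(3 / 4 : ℝ))) volume := by
    refine (Measurable.aestronglyMeasurable ?_)
    exact (measurable_const.add measurable_abs).pow_const _
  rw [memLp_two_iff_integrable_sq hmeas]
  have hint := integrable_one_add_norm (E := ℝ) (μ := volume) (r := 3 / 2)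
    (by rw [Module.finrank_self]; norm_num)
  refine hint.congr (ae_of_all _ fun x ↦ ?_)
  simp only [Real.norm_eq_abs]
  rw [← Real.rpow_two, ← Real.rpow_mul (by positivity)]
  norm_num

/-- **`𝔖_t ∈ L²(ℝ)` for every real `t`.** [cite: Suzuki2025WeilHilbertSpace, Prop. 1.2 (TeX l.376–383)] -/
theorem memLp_screwLine (t : ℝ) : MemLp (fun x : ℝ ↦ screwLine t x) 2 volume := by
  by_cases ht : t = 0
  · subst ht
    have : (fun x : ℝ ↦ screwLine 0 (x : ℂ)) = fun _ ↦ (0 : ℂ) :=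
      funext fun x ↦ screwLine_zero (by simp; norm_num)
    rw [this]
    exact MemLp.zero'
  obtain ⟨K, hK0, hK⟩ := norm_screwLine_le_log ht
  have hmaj : ∀ x : ℝ, ‖screwLine t x‖ ≤ 6 * K * (1 + |x|) ^ (-(3 / 4 : ℝ)) := by
    intro x
    refine (hK x).trans ?_
    have := one_add_log_div_le x
    calc K * ((1 + Real.log (2 + |x|)) / (1 + |x|)) ≤ K * (6 * (1 + |x|) ^ (-(3 / 4 : ℝ))) := by
          gcongr
      _ = 6 * K * (1 + |x|) ^ (-(3 / 4 : ℝ)) := by ring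
  have hg : MemLp (fun x : ℝ ↦ 6 * K * (1 + |x|) ^ (-(3 / 4 : ℝ))) 2 volume :=
    memLp_two_rpow_majorant.const_mul (6 * K)
  exact hg.mono' (measurable_screwLine ht).aestronglyMeasurable (ae_of_all _ hmaj)

/-! ## Uniformity in `t` on compact sets (for CJM Prop 1.3)

The constant of Prop 1.2 is made uniform for `|t| ≤ R` ("uniformly on every compact subset
of `t`", TeX l.1011–1013). The only `t`-sensitive estimate above is the geometric bound for the
Hurwitz–Lerch bracket; it is replaced by the harmonic-sum bound
`‖B(t,x)‖ ≤ 2 Σ_n (1/(n+¼) − 1/(n+¼+|x|/2)) ≤ 8(1 + log(2+|x|))`, valid for every `t`. -/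

/-- Telescoping: `Σ_{n<N} (f n − f(n+m)) = Σ_{n<m} f n − Σ_{n<m} f(N+n)`. [folklore] -/
private theorem sum_range_sub_shift (f : ℕ → ℝ) (m N : ℕ) :
    ∑ n ∈ Finset.range N, (f n - f (n + m)) =
      ∑ n ∈ Finset.range m, f n - ∑ n ∈ Finset.range m, f (N + n) := by
  induction N with
  | zero => simp
  | succ N ih =>
    rw [Finset.sum_range_succ, ih]
    have h1 := Finset.sum_range_succ (fun n ↦ f (N + n)) m
    have h2 := Finset.sum_range_succ' (fun n ↦ f (N + n)) m
    have h3 : ∑ n ∈ Finset.range m, f (N + 1 + n) = ∑ n ∈ Finset.range m, f (N + (n + 1)) :=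
      Finset.sum_congr rfl fun n _ ↦ by rw [add_assoc, add_comm 1 n]
    rw [h3]
    simp only [add_zero] at h2
    linarith

/-- For `0 ≤ y ≤ m`: `Σ_{n<N} (1/(n+¼) − 1/(n+¼+y)) ≤ Σ_{n<m} 1/(n+¼)`. [folklore] -/
private theorem sum_quarter_shift_le {y : ℝ} (hy : 0 ≤ y) {m : ℕ} (hym : y ≤ m) (N : ℕ) :
    ∑ n ∈ Finset.range N, (1 / ((n : ℝ) + 1 / 4) - 1 / ((n : ℝ) + 1 / 4 + y)) ≤
      ∑ n ∈ Finset.range m, 1 / ((n : ℝ) + 1 / 4) := by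
  calc ∑ n ∈ Finset.range N, (1 / ((n : ℝ) + 1 / 4) - 1 / ((n : ℝ) + 1 / 4 + y))
      ≤ ∑ n ∈ Finset.range N, (1 / ((n : ℝ) + 1 / 4) - 1 / (((n + m : ℕ) : ℝ) + 1 / 4)) := by
        refine Finset.sum_le_sum fun n _ ↦ ?_
        have hn : (0 : ℝ) ≤ n := n.cast_nonneg
        have h : 1 / (((n + m : ℕ) : ℝ) + 1 / 4) ≤ 1 / ((n : ℝ) + 1 / 4 + y) := by
          apply one_div_le_one_div_of_le (by positivity)
          push_cast; linarith
        linarith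
    _ = ∑ n ∈ Finset.range m, 1 / ((n : ℝ) + 1 / 4) -
          ∑ n ∈ Finset.range m, 1 / (((N + n : ℕ) : ℝ) + 1 / 4) :=
        sum_range_sub_shift (fun n ↦ 1 / ((n : ℝ) + 1 / 4)) m N
    _ ≤ ∑ n ∈ Finset.range m, 1 / ((n : ℝ) + 1 / 4) := by
        have : 0 ≤ ∑ n ∈ Finset.range m, 1 / (((N + n : ℕ) : ℝ) + 1 / 4) :=
          Finset.sum_nonneg fun n _ ↦ by positivity
        linarith

/-- `Σ_{n<m} 1/(n+¼) ≤ 4(1 + log m)` (harmonic bound `H_m ≤ 1 + log m`). [folklore] -/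
private theorem sum_quarter_le_log (m : ℕ) :
    ∑ n ∈ Finset.range m, 1 / ((n : ℝ) + 1 / 4) ≤ 4 * (1 + Real.log m) := by
  have h1 : ∑ n ∈ Finset.range m, 1 / ((n : ℝ) + 1 / 4) ≤
      4 * ∑ n ∈ Finset.range m, ((n + 1 : ℕ) : ℝ)⁻¹ := by
    rw [Finset.mul_sum]
    refine Finset.sum_le_sum fun n _ ↦ ?_
    have hn : (0 : ℝ) ≤ n := n.cast_nonneg
    push_cast
    rw [← one_div, mul_one_div, div_le_div_iff₀ (by positivity) (by positivity)]
    linarith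
  have h2 : (∑ n ∈ Finset.range m, ((n + 1 : ℕ) : ℝ)⁻¹) = ((harmonic m : ℚ) : ℝ) := by
    simp only [harmonic]; push_cast; rfl
  have h3 := harmonic_le_one_add_log m
  rw [h2] at h1
  linarith

/-- **Uniform bracket bound**: `‖B(t,x)‖ ≤ 8(1 + log(2+|x|))` for all real `t`, `x`
(`|1/(n+w) − 1/(n+¼)| ≤ 2(1/(n+¼) − 1/(n+¼+|x|/2))`, `w = ¼ − ix/2`, then the two lemmas above with
`m = ⌈|x|/2⌉`). [folklore] -/
private theorem norm_screwLerchBracket_le_log (t x : ℝ) :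
    ‖screwLerchBracket t x‖ ≤ 8 * (1 + Real.log (2 + |x|)) := by
  set y : ℝ := |x| / 2 with hy
  have hy0 : 0 ≤ y := by positivity
  set m : ℕ := ⌈y⌉₊ with hm
  have hym : y ≤ m := Nat.le_ceil y
  have hm1 : (m : ℝ) < y + 1 := Nat.ceil_lt_add_one hy0
  -- the majorant
  set g : ℕ → ℝ := fun n ↦ 2 * (1 / ((n : ℝ) + 1 / 4) - 1 / ((n : ℝ) + 1 / 4 + y)) with hg
  have hg0 : ∀ n, 0 ≤ g n := fun n ↦ by
    have hn : (0 : ℝ) ≤ n := n.cast_nonneg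
    have : 1 / ((n : ℝ) + 1 / 4 + y) ≤ 1 / ((n : ℝ) + 1 / 4) :=
      one_div_le_one_div_of_le (by positivity) (by linarith)
    simp only [hg]; linarith
  have hterm : ∀ n : ℕ, ‖(Real.exp (-(2 * |t| * n)) : ℂ) *
      (1 / ((n : ℂ) + (1 / 2 - I * x) / 2) - 1 / ((n : ℂ) + 1 / 4))‖ ≤ g n := by
    intro n
    have hk : (0 : ℝ) ≤ n := n.cast_nonneg
    have hq : ((n : ℂ) + 1 / 4) ≠ 0 := by
      intro h; have := congrArg Complex.re h; simp at this; linarith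
    have hw : ((n : ℂ) + (1 / 2 - I * x) / 2) ≠ 0 := by
      intro h; have := congrArg Complex.re h; simp at this; linarith
    have hexp : ‖(Real.exp (-(2 * |t| * n)) : ℂ)‖ ≤ 1 := by
      rw [Complex.norm_real, Real.norm_eq_abs, abs_of_pos (Real.exp_pos _), Real.exp_le_one_iff]
      have : 0 ≤ 2 * |t| * n := by positivity
      linarith
    have hdiff : 1 / ((n : ℂ) + (1 / 2 - I * x) / 2) - 1 / ((n : ℂ) + 1 / 4) =
        (((x / 2 : ℝ) : ℂ) * I) / (((n : ℂ) + (1 / 2 - I * x) / 2) * ((n : ℂ) + 1 / 4)) := by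
      rw [div_sub_div _ _ hw hq]
      congr 1; push_cast; ring
    have hq' : ‖(n : ℂ) + 1 / 4‖ = (n : ℝ) + 1 / 4 := by
      have : ((n : ℂ) + 1 / 4) = (((n : ℝ) + 1 / 4 : ℝ) : ℂ) := by push_cast; ring
      rw [this, Complex.norm_real, Real.norm_eq_abs, abs_of_pos (by positivity)]
    -- `‖n + w‖ ≥ (n + ¼ + y)/2`
    have hw' : ((n : ℝ) + 1 / 4 + y) / 2 ≤ ‖(n : ℂ) + (1 / 2 - I * x) / 2‖ := by
      have hre := Complex.abs_re_le_norm ((n : ℂ) + (1 / 2 - I * x) / 2)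
      have him := Complex.abs_im_le_norm ((n : ℂ) + (1 / 2 - I * x) / 2)
      have e1 : ((n : ℂ) + (1 / 2 - I * x) / 2).re = n + 1 / 4 := by norm_num
      have e2 : ((n : ℂ) + (1 / 2 - I * x) / 2).im = -(x / 2) := by norm_num; ring
      rw [e1, abs_of_pos (by positivity)] at hre
      rw [e2, abs_neg, abs_div, abs_two] at him
      rw [hy]; linarith
    have hpos : (0 : ℝ) < (n : ℝ) + 1 / 4 := by positivity
    have hpos' : (0 : ℝ) < ((n : ℝ) + 1 / 4 + y) / 2 := by positivity
    have hnum : ‖(((x / 2 : ℝ) : ℂ) * I)‖ = y := by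
      rw [norm_mul, Complex.norm_I, mul_one, Complex.norm_real, Real.norm_eq_abs, abs_div, abs_two,
        hy]
    rw [norm_mul, hdiff, norm_div, hnum, norm_mul, hq']
    have hpf : g n = 2 * y / (((n : ℝ) + 1 / 4) * ((n : ℝ) + 1 / 4 + y)) := by
      simp only [hg]
      rw [div_sub_div _ _ hpos.ne' (by positivity)]
      field_simp
      ring
    calc ‖(Real.exp (-(2 * |t| * n)) : ℂ)‖ * (y / (‖(n : ℂ) + (1 / 2 - I * x) / 2‖ * ((n : ℝ) + 1 / 4)))
        ≤ 1 * (y / ((((n : ℝ) + 1 / 4 + y) / 2) * ((n : ℝ) + 1 / 4))) := by gcongr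
      _ = 2 * y / (((n : ℝ) + 1 / 4) * ((n : ℝ) + 1 / 4 + y)) := by
          field_simp
      _ = g n := hpf.symm
  -- sum the majorant
  have hgsum : ∀ N, ∑ n ∈ Finset.range N, g n ≤ 8 * (1 + Real.log m) := fun N ↦ by
    have h := sum_quarter_shift_le hy0 hym N
    have h' := sum_quarter_le_log m
    simp only [hg, ← Finset.mul_sum]
    linarith
  have hgs : Summable g := by
    refine summable_of_sum_range_le hg0 hgsum
  have hB : ‖screwLerchBracket t x‖ ≤ ∑' n, g n :=
    tsum_of_norm_bounded hgs.hasSum hterm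
  have htsum : ∑' n, g n ≤ 8 * (1 + Real.log m) := Real.tsum_le_of_sum_range_le hg0 hgsum
  have hlog : Real.log m ≤ Real.log (2 + |x|) := by
    by_cases hm0 : m = 0
    · rw [hm0, Nat.cast_zero, Real.log_zero]; exact Real.log_nonneg (by linarith [abs_nonneg x])
    · exact Real.log_le_log (by exact_mod_cast Nat.pos_of_ne_zero hm0) (by linarith)
  linarith

/-- **Locally uniform global bound**: for every `R` there is `K` with
`‖𝔖_t(x)‖ ≤ K(1 + log(2+|x|))/(1+|x|)` for all real `x` and all `|t| ≤ R`
("uniformly on every compact subset of `t`"). [cite: Suzuki2025WeilHilbertSpace, §3.2 (TeX l.1008–1015)] -/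
theorem norm_screwLine_le_log_unif (R : ℝ) :
    ∃ K : ℝ, 0 ≤ K ∧ ∀ t x : ℝ, |t| ≤ R →
      ‖screwLine t x‖ ≤ K * ((1 + Real.log (2 + |x|)) / (1 + |x|)) := by
  set S : ℝ := (∑' n : ℕ, 1 / ((n : ℝ) + 1 / 4) ^ 2)
  have hS : 0 ≤ S := quarterSqSum_nonneg
  set M₁ : ℝ := ‖Complex.digamma (1 / 4)‖ + S / 2 + 8 with hM₁
  have hM₁ : 0 ≤ M₁ := by positivity
  set C₄ : ℝ := ∑ n ∈ Finset.Icc 1 ⌊Real.exp |R|⌋₊, ArithmeticFunction.vonMangoldt n / Real.sqrt n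
    with hC₄d
  have hC₄ : 0 ≤ C₄ := Finset.sum_nonneg fun n _ ↦
    div_nonneg ArithmeticFunction.vonMangoldt_nonneg (Real.sqrt_nonneg _)
  refine ⟨8 * Real.exp (|R| / 2) + 8 + C₄ * (2 * |R| + 4) +
      (S / 2 + M₁ + ‖Complex.digamma (1 / 4)‖ + 1) + (S / 2 + 12) +
      ((2 * |R| + 4) * (6 + M₁ / 2) + (|R| + 2)), by positivity, fun t x ht ↦ ?_⟩
  set a : ℝ := |t| with ha
  have ha0 : 0 ≤ a := abs_nonneg t
  have haR : a ≤ |R| := ht.trans (le_abs_self R)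
  set D : ℝ := 1 + |x| with hD
  have hD0 : 0 < D := by positivity
  have hD1 : 1 ≤ D := by rw [hD]; linarith [abs_nonneg x]
  set L : ℝ := Real.log (2 + |x|) with hL
  have hL0 : 0 ≤ L := Real.log_nonneg (by linarith [abs_nonneg x])
  set Q : ℝ := (1 + L) / D with hQ
  have hQ0 : 0 ≤ Q := by positivity
  have h1D : 1 / D ≤ Q := by rw [hQ]; gcongr; linarith
  have hLD : L / D ≤ Q := by rw [hQ]; gcongr; linarith
  have hψ : ‖Complex.digamma (1 / 4 - I * x / 2)‖ ≤ M₁ + L := norm_digamma_quarter_line_le x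
  have hψq := norm_nonneg (Complex.digamma (1 / 4))
  -- the six bounds, constants depending on `R` only
  have hT1 : ‖4 * ((Real.exp (|t| / 2) - 1 : ℝ) : ℂ) / (1 + 2 * I * x)‖ ≤
      8 * Real.exp (|R| / 2) * Q := by
    have h := norm_div_one_add_le (4 * ((Real.exp (|t| / 2) - 1 : ℝ) : ℂ)) x 1 (Or.inl rfl)
    have e : ((1 : ℝ) : ℂ) * (2 * I * x) = 2 * I * x := by push_cast; ring
    rw [e] at h
    refine h.trans ?_
    rw [norm_mul, Complex.norm_real, Real.norm_eq_abs, show ‖(4 : ℂ)‖ = 4 by simp]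
    have hb : |Real.exp (|t| / 2) - 1| ≤ Real.exp (|R| / 2) := by
      rw [abs_of_nonneg (by linarith [Real.one_le_exp (by positivity : 0 ≤ |t| / 2)])]
      have := Real.exp_le_exp.2 (by linarith : |t| / 2 ≤ |R| / 2)
      linarith [Real.exp_pos (|R| / 2)]
    calc 2 * (4 * |Real.exp (|t| / 2) - 1|) / (1 + |x|) = 8 * |Real.exp (|t| / 2) - 1| * (1 / D) := by
          rw [hD]; ring
      _ ≤ 8 * Real.exp (|R| / 2) * Q := by gcongr
  have hT2 : ‖4 * ((Real.exp (-(|t| / 2)) - 1 : ℝ) : ℂ) / (1 - 2 * I * x)‖ ≤ 8 * Q := by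
    have h := norm_div_one_add_le (4 * ((Real.exp (-(|t| / 2)) - 1 : ℝ) : ℂ)) x (-1) (Or.inr rfl)
    have e : (1 : ℂ) + ((-1 : ℝ) : ℂ) * (2 * I * x) = 1 - 2 * I * x := by push_cast; ring
    rw [e] at h
    refine h.trans ?_
    rw [norm_mul, Complex.norm_real, Real.norm_eq_abs, show ‖(4 : ℂ)‖ = 4 by simp]
    have hb : |Real.exp (-(|t| / 2)) - 1| ≤ 1 := by
      rw [abs_sub_comm, abs_of_nonneg (by
        have := Real.exp_le_one_iff.2 (by linarith [abs_nonneg t] : -(|t| / 2) ≤ 0); linarith)]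
      linarith [Real.exp_pos (-(|t| / 2))]
    calc 2 * (4 * |Real.exp (-(|t| / 2)) - 1|) / (1 + |x|) =
        8 * |Real.exp (-(|t| / 2)) - 1| * (1 / D) := by rw [hD]; ring
      _ ≤ 8 * 1 * Q := by gcongr
      _ = 8 * Q := by ring
  have hT3 : ‖(cexp (-(I * x * (|t| : ℝ))) - 1) / (I * x) *
      (I * (1 + sharp lagariasTheta x) / 2 *
        (deriv riemannZeta (1 / 2 - I * x) / riemannZeta (1 / 2 - I * x)))‖ ≤
      ((2 * |R| + 4) * (6 + M₁ / 2) + (|R| + 2)) * Q := by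
    rw [norm_mul]
    have hP := norm_expFactor_le x (u := |t|) (a := a) (abs_nonneg t) (by rw [ha])
    have hZ := norm_thetaFactor_mul_logDeriv_zeta_le x
    calc ‖(cexp (-(I * x * (|t| : ℝ))) - 1) / (I * x)‖ *
        ‖I * (1 + sharp lagariasTheta x) / 2 *
          (deriv riemannZeta (1 / 2 - I * x) / riemannZeta (1 / 2 - I * x))‖
        ≤ ((2 * a + 4) / (1 + |x|)) * (6 + ‖Complex.digamma (1 / 4 - I * x / 2)‖ / 2) := by
          gcongr
      _ ≤ ((2 * a + 4) / D) * (6 + (M₁ + L) / 2) := by rw [hD]; gcongr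
      _ = (2 * a + 4) * (6 + M₁ / 2) * (1 / D) + (a + 2) * (L / D) := by ring
      _ ≤ (2 * a + 4) * (6 + M₁ / 2) * Q + (a + 2) * Q := by gcongr
      _ ≤ (2 * |R| + 4) * (6 + M₁ / 2) * Q + (|R| + 2) * Q := by gcongr
      _ = ((2 * |R| + 4) * (6 + M₁ / 2) + (|R| + 2)) * Q := by ring
  have hT4 : ‖∑ n ∈ Finset.Icc 1 ⌊Real.exp |t|⌋₊,
      ((ArithmeticFunction.vonMangoldt n / Real.sqrt n : ℝ) : ℂ) *
        ((cexp (-(I * x * ((|t| - Real.log n : ℝ) : ℂ))) - 1) / (I * x))‖ ≤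
      C₄ * (2 * |R| + 4) * Q := by
    refine (norm_primeTerm_le t x).trans ?_
    have hsub : (∑ n ∈ Finset.Icc 1 ⌊Real.exp |t|⌋₊, ArithmeticFunction.vonMangoldt n / Real.sqrt n)
        ≤ C₄ := by
      refine Finset.sum_le_sum_of_subset_of_nonneg (Finset.Icc_subset_Icc_right
        (Nat.floor_le_floor (Real.exp_le_exp.2 haR))) fun n _ _ ↦
        div_nonneg ArithmeticFunction.vonMangoldt_nonneg (Real.sqrt_nonneg _)
    have hnn : 0 ≤ ∑ n ∈ Finset.Icc 1 ⌊Real.exp |t|⌋₊, ArithmeticFunction.vonMangoldt n / Real.sqrt n :=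
      Finset.sum_nonneg fun n _ ↦ div_nonneg ArithmeticFunction.vonMangoldt_nonneg (Real.sqrt_nonneg _)
    rw [← hD]
    calc (∑ n ∈ Finset.Icc 1 ⌊Real.exp |t|⌋₊, ArithmeticFunction.vonMangoldt n / Real.sqrt n) *
        ((2 * |t| + 4) / D)
        = (∑ n ∈ Finset.Icc 1 ⌊Real.exp |t|⌋₊, ArithmeticFunction.vonMangoldt n / Real.sqrt n) *
            (2 * |t| + 4) * (1 / D) := by ring
      _ ≤ C₄ * (2 * |R| + 4) * Q := by gcongr
  have hQhalf : |x| ≤ 1 → 1 / 2 ≤ Q := fun hx ↦ by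
    have : 1 / 2 ≤ 1 / D := by
      rw [hD, div_le_div_iff₀ (by norm_num) hD0]; linarith
    exact this.trans h1D
  have hDx : 1 < |x| → 1 / (2 * |x|) ≤ 1 / D := fun hx ↦ by
    rw [hD]; gcongr; linarith
  have hT5 : ‖1 / (2 * I * x) * (Complex.digamma (1 / 4 - I * x / 2) - Complex.digamma (1 / 4))‖ ≤
      (S / 2 + M₁ + ‖Complex.digamma (1 / 4)‖ + 1) * Q := by
    by_cases hx0 : x = 0
    · have : (1 : ℂ) / (2 * I * ((0 : ℝ) : ℂ)) = 0 := by simp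
      rw [hx0, this, zero_mul, norm_zero]; positivity
    have hxpos : 0 < |x| := abs_pos.2 hx0
    have hn : ‖1 / (2 * I * (x : ℂ))‖ = 1 / (2 * |x|) := by
      rw [norm_div, norm_one, norm_mul, norm_mul, Complex.norm_two, Complex.norm_I, mul_one,
        Complex.norm_real, Real.norm_eq_abs]
    rw [norm_mul, hn]
    rcases le_or_gt |x| 1 with hx | hx
    · have h := norm_digamma_sub_quarter_le x
      have hq := hQhalf hx
      calc 1 / (2 * |x|) * ‖Complex.digamma (1 / 4 - I * x / 2) - Complex.digamma (1 / 4)‖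
          ≤ 1 / (2 * |x|) * (S * (|x| / 2)) := by gcongr
        _ = (S / 2) * (1 / 2) := by field_simp
        _ ≤ (S / 2) * Q := by gcongr
        _ ≤ (S / 2 + M₁ + ‖Complex.digamma (1 / 4)‖ + 1) * Q := by gcongr; linarith
    · have h : ‖Complex.digamma (1 / 4 - I * x / 2) - Complex.digamma (1 / 4)‖ ≤
          (M₁ + ‖Complex.digamma (1 / 4)‖) + L := (norm_sub_le _ _).trans (by linarith)
      have hd := hDx hx
      have e1 : (M₁ + ‖Complex.digamma (1 / 4)‖) * (1 / D) ≤ (M₁ + ‖Complex.digamma (1 / 4)‖) * Q :=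
        mul_le_mul_of_nonneg_left h1D (by positivity)
      calc 1 / (2 * |x|) * ‖Complex.digamma (1 / 4 - I * x / 2) - Complex.digamma (1 / 4)‖
          ≤ 1 / D * ((M₁ + ‖Complex.digamma (1 / 4)‖) + L) := by gcongr
        _ = (M₁ + ‖Complex.digamma (1 / 4)‖) * (1 / D) + L / D := by ring
        _ ≤ (M₁ + ‖Complex.digamma (1 / 4)‖) * Q + Q := add_le_add e1 hLD
        _ = (M₁ + ‖Complex.digamma (1 / 4)‖ + 1) * Q := by ring
        _ ≤ (S / 2 + M₁ + ‖Complex.digamma (1 / 4)‖ + 1) * Q := by gcongr; linarith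
  have hT6 : ‖1 / (2 * I * x) * ((Real.exp (-(|t| / 2)) : ℝ) : ℂ) * screwLerchBracket t x‖ ≤
      (S / 2 + 12) * Q := by
    by_cases hx0 : x = 0
    · have : (1 : ℂ) / (2 * I * ((0 : ℝ) : ℂ)) = 0 := by simp
      rw [hx0, this, zero_mul, zero_mul, norm_zero]; positivity
    have hxpos : 0 < |x| := abs_pos.2 hx0
    have hn : ‖1 / (2 * I * (x : ℂ))‖ = 1 / (2 * |x|) := by
      rw [norm_div, norm_one, norm_mul, norm_mul, Complex.norm_two, Complex.norm_I, mul_one,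
        Complex.norm_real, Real.norm_eq_abs]
    have he : ‖((Real.exp (-(|t| / 2)) : ℝ) : ℂ)‖ ≤ 1 := by
      rw [Complex.norm_real, Real.norm_eq_abs, abs_of_pos (Real.exp_pos _), Real.exp_le_one_iff]
      linarith [abs_nonneg t]
    rw [norm_mul, norm_mul, hn]
    rcases le_or_gt |x| 1 with hx | hx
    · have h := norm_screwLerchBracket_le t x
      have hq := hQhalf hx
      calc 1 / (2 * |x|) * ‖((Real.exp (-(|t| / 2)) : ℝ) : ℂ)‖ * ‖screwLerchBracket t x‖
          ≤ 1 / (2 * |x|) * 1 * (|x| / 2 * S) := by gcongr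
        _ = (S / 2) * (1 / 2) := by field_simp
        _ ≤ (S / 2) * Q := by gcongr
        _ ≤ (S / 2 + 12) * Q := by gcongr; linarith
    · have h := norm_screwLerchBracket_le_log t x
      have hd := hDx hx
      calc 1 / (2 * |x|) * ‖((Real.exp (-(|t| / 2)) : ℝ) : ℂ)‖ * ‖screwLerchBracket t x‖
          ≤ 1 / D * 1 * (8 * (1 + L)) := by gcongr
        _ = 8 * Q := by rw [hQ]; ring
        _ ≤ (S / 2 + 12) * Q := by gcongr; linarith
  -- assemble (as in `norm_screwLine_le_log`)
  rw [screwLine_ofReal_eq]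
  set c := I * (1 + sharp lagariasTheta (x : ℂ)) / 2 with hc
  have hcn : ‖c‖ ≤ 1 := norm_thetaFactor_le x
  set T1 := 4 * ((Real.exp (|t| / 2) - 1 : ℝ) : ℂ) / (1 + 2 * I * x) with hT1d
  set T2 := 4 * ((Real.exp (-(|t| / 2)) - 1 : ℝ) : ℂ) / (1 - 2 * I * x) with hT2d
  set P := (cexp (-(I * x * (|t| : ℝ))) - 1) / (I * x) with hPd
  set Z := deriv riemannZeta (1 / 2 - I * x) / riemannZeta (1 / 2 - I * x) with hZd
  set T4 := ∑ n ∈ Finset.Icc 1 ⌊Real.exp |t|⌋₊,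
      ((ArithmeticFunction.vonMangoldt n / Real.sqrt n : ℝ) : ℂ) *
        ((cexp (-(I * x * ((|t| - Real.log n : ℝ) : ℂ))) - 1) / (I * x)) with hT4d
  set T5 := 1 / (2 * I * x) * (Complex.digamma (1 / 4 - I * x / 2) - Complex.digamma (1 / 4))
    with hT5d
  set T6 := 1 / (2 * I * x) * ((Real.exp (-(|t| / 2)) : ℝ) : ℂ) * screwLerchBracket t x with hT6d
  have hsplit : c * (T1 + T2 + P * Z + T4 - T5 - T6) =
      c * (T1 + T2 + T4 - T5 - T6) + P * (c * Z) := by ring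
  rw [hsplit]
  have hrest : ‖c * (T1 + T2 + T4 - T5 - T6)‖ ≤ ‖T1‖ + ‖T2‖ + ‖T4‖ + ‖T5‖ + ‖T6‖ := by
    rw [norm_mul]
    have h : ‖T1 + T2 + T4 - T5 - T6‖ ≤ ‖T1‖ + ‖T2‖ + ‖T4‖ + ‖T5‖ + ‖T6‖ := by
      have h1 := norm_sub_le (T1 + T2 + T4 - T5) T6
      have h2 := norm_sub_le (T1 + T2 + T4) T5
      have h3 := norm_add_le (T1 + T2) T4
      have h4 := norm_add_le T1 T2
      linarith
    calc ‖c‖ * ‖T1 + T2 + T4 - T5 - T6‖ ≤ 1 * (‖T1‖ + ‖T2‖ + ‖T4‖ + ‖T5‖ + ‖T6‖) := by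
          gcongr
      _ = _ := one_mul _
  have hPZ : ‖P * (c * Z)‖ ≤ ((2 * |R| + 4) * (6 + M₁ / 2) + (|R| + 2)) * Q := by
    rw [hPd, hc, hZd]; exact hT3
  calc ‖c * (T1 + T2 + T4 - T5 - T6) + P * (c * Z)‖
      ≤ ‖c * (T1 + T2 + T4 - T5 - T6)‖ + ‖P * (c * Z)‖ := norm_add_le _ _
    _ ≤ (‖T1‖ + ‖T2‖ + ‖T4‖ + ‖T5‖ + ‖T6‖) + ((2 * |R| + 4) * (6 + M₁ / 2) + (|R| + 2)) * Q :=
        add_le_add hrest hPZ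
    _ ≤ (8 * Real.exp (|R| / 2) * Q + 8 * Q + C₄ * (2 * |R| + 4) * Q +
          (S / 2 + M₁ + ‖Complex.digamma (1 / 4)‖ + 1) * Q + (S / 2 + 12) * Q) +
          ((2 * |R| + 4) * (6 + M₁ / 2) + (|R| + 2)) * Q := by
        gcongr
    _ = _ := by ring

/-! ## CJM Prop 1.3: `P̂_φ ∈ L²(ℝ)` for `φ ∈ C_c^∞(ℝ)` -/

/-- Joint measurability of `(x,t) ↦ 𝔖_t(x)` on `ℝ × ℝ`. [folklore] -/
private theorem measurable_screwLine_uncurry :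
    Measurable fun p : ℝ × ℝ ↦ screwLine p.2 (p.1 : ℂ) := by
  have hofReal : Measurable (fun x : ℝ ↦ (x : ℂ)) := Complex.measurable_ofReal
  have mx : Measurable fun p : ℝ × ℝ ↦ (p.1 : ℂ) := hofReal.comp measurable_fst
  have ms : Measurable fun p : ℝ × ℝ ↦ (1 / 2 : ℂ) - I * (p.1 : ℂ) := by fun_prop
  have mζ : Measurable fun p : ℝ × ℝ ↦ riemannZeta (1 / 2 - I * (p.1 : ℂ)) :=
    measurable_riemannZeta.comp ms
  have mζ' : Measurable fun p : ℝ × ℝ ↦ deriv riemannZeta (1 / 2 - I * (p.1 : ℂ)) :=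
    (measurable_deriv riemannZeta).comp ms
  have mψ : Measurable fun p : ℝ × ℝ ↦ Complex.digamma (1 / 4 - I * (p.1 : ℂ) / 2) :=
    continuous_digamma_quarter_line.measurable.comp measurable_fst
  have mΘ : Measurable fun p : ℝ × ℝ ↦ sharp lagariasTheta (p.1 : ℂ) := by
    have : (fun p : ℝ × ℝ ↦ sharp lagariasTheta (p.1 : ℂ)) =
        fun p : ℝ × ℝ ↦ (starRingEnd ℂ) (lagariasTheta p.1) := funext fun p ↦ sharp_ofReal _ _
    rw [this]
    exact Complex.continuous_conj.measurable.comp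
      ((measurable_lagariasTheta.comp hofReal).comp measurable_fst)
  -- the bracket: pointwise limit of continuous partial sums
  have mB : Measurable fun p : ℝ × ℝ ↦ screwLerchBracket p.2 (p.1 : ℂ) := by
    have hterm : ∀ n : ℕ, Continuous fun p : ℝ × ℝ ↦ (Real.exp (-(2 * |p.2| * n)) : ℂ) *
        (1 / ((n : ℂ) + (1 / 2 - I * (p.1 : ℂ)) / 2) - 1 / ((n : ℂ) + 1 / 4)) := by
      intro n
      have hne : ∀ p : ℝ × ℝ, ((n : ℂ) + (1 / 2 - I * (p.1 : ℂ)) / 2) ≠ 0 := fun p h ↦ by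
        have := congrArg Complex.re h
        simp at this
        linarith [n.cast_nonneg (α := ℝ)]
      exact (by fun_prop : Continuous fun p : ℝ × ℝ ↦ (Real.exp (-(2 * |p.2| * n)) : ℂ)).mul
        ((continuous_const.div (by fun_prop) hne).sub continuous_const)
    refine measurable_of_tendsto_metrizable (f := fun N (p : ℝ × ℝ) ↦ ∑ n ∈ Finset.range N,
      (Real.exp (-(2 * |p.2| * n)) : ℂ) *
        (1 / ((n : ℂ) + (1 / 2 - I * (p.1 : ℂ)) / 2) - 1 / ((n : ℂ) + 1 / 4)))
      (fun N ↦ (continuous_finsetSum _ fun n _ ↦ hterm n).measurable) ?_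
    rw [tendsto_pi_nhds]
    intro p
    exact (summable_lerchTerms p.2 p.1).hasSum.tendsto_sum_nat
  have mexp : ∀ g : ℝ × ℝ → ℝ, Measurable g →
      Measurable fun p : ℝ × ℝ ↦ (cexp (-(I * (p.1 : ℂ) * ((g p : ℝ) : ℂ))) - 1) / (I * (p.1 : ℂ)) :=
    fun g hg ↦ ((Complex.measurable_exp.comp ((mx.const_mul I).mul (hofReal.comp hg)).neg).sub
      measurable_const).div (mx.const_mul I)
  have mabs : Measurable fun p : ℝ × ℝ ↦ |p.2| := measurable_snd.abs
  -- the prime sum with its `t`-dependent range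
  have mT4 : Measurable fun p : ℝ × ℝ ↦ ∑ n ∈ Finset.Icc 1 ⌊Real.exp |p.2|⌋₊,
      ((ArithmeticFunction.vonMangoldt n / Real.sqrt n : ℝ) : ℂ) *
        ((cexp (-(I * (p.1 : ℂ) * ((|p.2| - Real.log n : ℝ) : ℂ))) - 1) / (I * (p.1 : ℂ))) := by
    have hN : Measurable fun p : ℝ × ℝ ↦ ⌊Real.exp |p.2|⌋₊ :=
      Nat.measurable_floor.comp (Real.measurable_exp.comp mabs)
    have hG : Measurable fun q : (ℝ × ℝ) × ℕ ↦ ∑ n ∈ Finset.Icc 1 q.2,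
        ((ArithmeticFunction.vonMangoldt n / Real.sqrt n : ℝ) : ℂ) *
          ((cexp (-(I * (q.1.1 : ℂ) * ((|q.1.2| - Real.log n : ℝ) : ℂ))) - 1) / (I * (q.1.1 : ℂ))) := by
      refine measurable_from_prod_countable_left fun k ↦ ?_
      change Measurable fun p : ℝ × ℝ ↦ ∑ n ∈ Finset.Icc 1 k,
        ((ArithmeticFunction.vonMangoldt n / Real.sqrt n : ℝ) : ℂ) *
          ((cexp (-(I * (p.1 : ℂ) * ((|p.2| - Real.log n : ℝ) : ℂ))) - 1) / (I * (p.1 : ℂ)))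
      exact Finset.measurable_sum _ fun n _ ↦
        (mexp (fun p ↦ |p.2| - Real.log n) (mabs.sub_const _)).const_mul _
    have hcomp := hG.comp (measurable_id.prodMk hN)
    simpa only [Function.comp_def, id_eq] using hcomp
  have hfun : (fun p : ℝ × ℝ ↦ screwLine p.2 (p.1 : ℂ)) = fun p : ℝ × ℝ ↦
      I * (1 + sharp lagariasTheta (p.1 : ℂ)) / 2 *
      (4 * ((Real.exp (|p.2| / 2) - 1 : ℝ) : ℂ) / (1 + 2 * I * (p.1 : ℂ)) +
        4 * ((Real.exp (-(|p.2| / 2)) - 1 : ℝ) : ℂ) / (1 - 2 * I * (p.1 : ℂ)) +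
        (cexp (-(I * (p.1 : ℂ) * (|p.2| : ℝ))) - 1) / (I * (p.1 : ℂ)) *
          (deriv riemannZeta (1 / 2 - I * (p.1 : ℂ)) / riemannZeta (1 / 2 - I * (p.1 : ℂ))) +
        (∑ n ∈ Finset.Icc 1 ⌊Real.exp |p.2|⌋₊,
          ((ArithmeticFunction.vonMangoldt n / Real.sqrt n : ℝ) : ℂ) *
            ((cexp (-(I * (p.1 : ℂ) * ((|p.2| - Real.log n : ℝ) : ℂ))) - 1) / (I * (p.1 : ℂ)))) -
        1 / (2 * I * (p.1 : ℂ)) *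
          (Complex.digamma (1 / 4 - I * (p.1 : ℂ) / 2) - Complex.digamma (1 / 4)) -
        1 / (2 * I * (p.1 : ℂ)) * ((Real.exp (-(|p.2| / 2)) : ℝ) : ℂ) *
          screwLerchBracket p.2 (p.1 : ℂ)) :=
    funext fun p ↦ screwLine_ofReal_eq p.2 p.1
  rw [hfun]
  have m1 : Measurable fun p : ℝ × ℝ ↦ I * (1 + sharp lagariasTheta (p.1 : ℂ)) / 2 :=
    ((measurable_const.mul (measurable_const.add mΘ)).div measurable_const)
  have mT1 : Measurable fun p : ℝ × ℝ ↦
      4 * ((Real.exp (|p.2| / 2) - 1 : ℝ) : ℂ) / (1 + 2 * I * (p.1 : ℂ)) :=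
    (measurable_const.mul (hofReal.comp ((Real.measurable_exp.comp
      (mabs.div_const 2)).sub_const 1))).div (by fun_prop)
  have mT2 : Measurable fun p : ℝ × ℝ ↦
      4 * ((Real.exp (-(|p.2| / 2)) - 1 : ℝ) : ℂ) / (1 - 2 * I * (p.1 : ℂ)) :=
    (measurable_const.mul (hofReal.comp ((Real.measurable_exp.comp
      (mabs.div_const 2).neg).sub_const 1))).div (by fun_prop)
  have mT3 : Measurable fun p : ℝ × ℝ ↦ (cexp (-(I * (p.1 : ℂ) * (|p.2| : ℝ))) - 1) / (I * (p.1 : ℂ)) *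
      (deriv riemannZeta (1 / 2 - I * (p.1 : ℂ)) / riemannZeta (1 / 2 - I * (p.1 : ℂ))) :=
    (mexp (fun p ↦ |p.2|) mabs).mul (mζ'.div mζ)
  have m2Ix : Measurable fun p : ℝ × ℝ ↦ 1 / (2 * I * (p.1 : ℂ)) :=
    measurable_const.div (by fun_prop)
  have mT5 : Measurable fun p : ℝ × ℝ ↦ 1 / (2 * I * (p.1 : ℂ)) *
      (Complex.digamma (1 / 4 - I * (p.1 : ℂ) / 2) - Complex.digamma (1 / 4)) :=
    m2Ix.mul (mψ.sub measurable_const)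
  have mT6 : Measurable fun p : ℝ × ℝ ↦
      1 / (2 * I * (p.1 : ℂ)) * ((Real.exp (-(|p.2| / 2)) : ℝ) : ℂ) * screwLerchBracket p.2 (p.1 : ℂ) :=
    (m2Ix.mul (hofReal.comp (Real.measurable_exp.comp (mabs.div_const 2).neg))).mul mB
  exact m1.mul (((((mT1.add mT2).add mT3).add mT4).sub mT5).sub mT6)

/-- `x ↦ P̂_φ(x)` is a.e.-strongly measurable on `ℝ` (Fubini measurability of the Bochner integral
of the jointly measurable integrand `(x,t) ↦ 𝔖_t♯(x)φ(t)`). [folklore] -/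
private theorem aestronglyMeasurable_screwPhat {φ : ℝ → ℂ} (hφ : IsWeilTest φ) :
    AEStronglyMeasurable (fun x : ℝ ↦ screwPhat φ x) volume := by
  have hF : Measurable (fun p : ℝ × ℝ ↦ sharp (screwLine p.2) (p.1 : ℂ) * φ p.2) := by
    have : (fun p : ℝ × ℝ ↦ sharp (screwLine p.2) (p.1 : ℂ) * φ p.2) =
        fun p ↦ (starRingEnd ℂ) (screwLine p.2 (p.1 : ℂ)) * φ p.2 :=
      funext fun p ↦ by rw [sharp_ofReal]
    rw [this]
    exact (Complex.continuous_conj.measurable.comp measurable_screwLine_uncurry).mul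
      (hφ.1.continuous.measurable.comp measurable_snd)
  exact (StronglyMeasurable.integral_prod_right
    (f := fun (x : ℝ) (t : ℝ) ↦ sharp (screwLine t) (x : ℂ) * φ t) hF.stronglyMeasurable
      (ν := volume)).aestronglyMeasurable

/-- Pointwise majorant: `‖P̂_φ(x)‖ ≤ 6K_R‖φ‖₁ (1+|x|)^{-3/4}` when `supp φ ⊆ [−R, R]`.
[cite: Suzuki2025WeilHilbertSpace, Prop. 1.3 (TeX l.392–405)] -/
theorem norm_screwPhat_le {φ : ℝ → ℂ} (hφ : IsWeilTest φ) :
    ∃ C : ℝ, ∀ x : ℝ, ‖screwPhat φ x‖ ≤ C * (1 + |x|) ^ (-(3 / 4 : ℝ)) := by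
  obtain ⟨R, -, hR⟩ := hφ.2.exists_pos_le_norm
  obtain ⟨K, hK0, hK⟩ := norm_screwLine_le_log_unif R
  have hφi : Integrable (fun t : ℝ ↦ ‖φ t‖) :=
    (hφ.1.continuous.integrable_of_hasCompactSupport hφ.2).norm
  refine ⟨6 * K * ∫ t, ‖φ t‖, fun x ↦ ?_⟩
  have hpow : 0 ≤ (1 + |x|) ^ (-(3 / 4 : ℝ)) := Real.rpow_nonneg (by positivity) _
  have hbound : ∀ t : ℝ, ‖sharp (screwLine t) (x : ℂ) * φ t‖ ≤
      6 * K * (1 + |x|) ^ (-(3 / 4 : ℝ)) * ‖φ t‖ := by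
    intro t
    rw [norm_mul, sharp_ofReal, Complex.norm_conj]
    by_cases ht : |t| ≤ R
    · gcongr
      refine (hK t x ht).trans ?_
      have := one_add_log_div_le x
      calc K * ((1 + Real.log (2 + |x|)) / (1 + |x|)) ≤ K * (6 * (1 + |x|) ^ (-(3 / 4 : ℝ))) := by
            gcongr
        _ = 6 * K * (1 + |x|) ^ (-(3 / 4 : ℝ)) := by ring
    · have h0 : φ t = 0 := hR t (by rw [Real.norm_eq_abs]; linarith)
      simp [h0]
  unfold screwPhat
  calc ‖∫ t, sharp (screwLine t) (x : ℂ) * φ t‖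
      ≤ ∫ t, 6 * K * (1 + |x|) ^ (-(3 / 4 : ℝ)) * ‖φ t‖ :=
        norm_integral_le_of_norm_le (hφi.const_mul _) (ae_of_all _ hbound)
    _ = 6 * K * (∫ t, ‖φ t‖) * (1 + |x|) ^ (-(3 / 4 : ℝ)) := by
        rw [integral_const_mul]; ring

/-- **`P̂_φ ∈ L²(ℝ)` for `φ ∈ C_c^∞(ℝ)`.** [cite: Suzuki2025WeilHilbertSpace, Prop. 1.3 (TeX l.392–405)] -/
theorem memLp_screwPhat {φ : ℝ → ℂ} (hφ : IsWeilTest φ) :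
    MemLp (fun x : ℝ ↦ screwPhat φ x) 2 volume := by
  obtain ⟨C, hC⟩ := norm_screwPhat_le hφ
  exact (memLp_two_rpow_majorant.const_mul C).mono' (aestronglyMeasurable_screwPhat hφ)
    (ae_of_all _ hC)

/-! ## CJM Lemma 3.2 (i), (ii): `‖·‖₀` is a seminorm on `C_c^∞(ℝ)` (RH-FREE)

`‖ψ‖₀ = (π⁻¹ ∫|P̂_{Dψ}|²)^{1/2}` (3.9). Subadditivity and absolute homogeneity follow from the
linearity of `φ ↦ P̂_φ` (an integral against the compactly supported `φ = Dψ`) and Minkowski's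
inequality in `L²(ℝ)` (available by Prop 1.3). Definiteness (iii) rests on (3.5)/(3.8) and
[Suzuki JLMS 2023, Lemma 2.1]; it is NOT proved here (`Suzuki2025_lemma32_of_definite` records the
reduction). -/

/-- `D(ψ₁ + ψ₂) = Dψ₁ + Dψ₂` for smooth `ψᵢ`. [folklore] -/
private theorem suzukiD_add {ψ₁ ψ₂ : ℝ → ℂ} (h₁ : IsWeilTest ψ₁) (h₂ : IsWeilTest ψ₂) :
    suzukiD (ψ₁ + ψ₂) = suzukiD ψ₁ + suzukiD ψ₂ := by
  funext t
  simp only [suzukiD, Pi.add_apply]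
  rw [deriv_add (h₁.1.differentiable (by simp) t) (h₂.1.differentiable (by simp) t)]
  ring

/-- `D(kψ) = k·Dψ` for smooth `ψ`. [folklore] -/
private theorem suzukiD_smul {ψ : ℝ → ℂ} (h : IsWeilTest ψ) (k : ℂ) :
    suzukiD (k • ψ) = fun t ↦ k * suzukiD ψ t := by
  funext t
  simp only [suzukiD]
  rw [show k • ψ = fun y ↦ k * ψ y from rfl, deriv_const_mul k (h.1.differentiable (by simp) t)]
  ring

/-- `Dψ ∈ C_c^∞(ℝ)` for `ψ ∈ C_c^∞(ℝ)`. [folklore] -/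
private theorem isWeilTest_suzukiD {ψ : ℝ → ℂ} (h : IsWeilTest ψ) : IsWeilTest (suzukiD ψ) := by
  unfold suzukiD
  exact h.deriv.const_mul I

/-- `P̂_{kφ} = k P̂_φ` (no hypotheses). [folklore] -/
private theorem screwPhat_const_mul (φ : ℝ → ℂ) (k : ℂ) (z : ℂ) :
    screwPhat (fun t ↦ k * φ t) z = k * screwPhat φ z := by
  unfold screwPhat
  rw [← integral_const_mul]
  congr 1 with t
  ring

/-- The integrand `t ↦ 𝔖_t♯(x)φ(t)` of `P̂_φ(x)` is integrable for `φ ∈ C_c^∞(ℝ)` and real `x`.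
[folklore] -/
private theorem integrable_screwPhat_integrand {φ : ℝ → ℂ} (hφ : IsWeilTest φ) (x : ℝ) :
    Integrable (fun t : ℝ ↦ sharp (screwLine t) (x : ℂ) * φ t) := by
  obtain ⟨R, -, hR⟩ := hφ.2.exists_pos_le_norm
  obtain ⟨K, hK0, hK⟩ := norm_screwLine_le_log_unif R
  have hmeas : AEStronglyMeasurable (fun t : ℝ ↦ sharp (screwLine t) (x : ℂ) * φ t) volume := by
    have h1 : Measurable fun t : ℝ ↦ screwLine t (x : ℂ) := by
      have h := measurable_screwLine_uncurry.comp ((measurable_const (a := x)).prodMk measurable_id)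
      simpa only [Function.comp_def, id_eq] using h
    have : (fun t : ℝ ↦ sharp (screwLine t) (x : ℂ) * φ t) =
        fun t ↦ (starRingEnd ℂ) (screwLine t (x : ℂ)) * φ t := funext fun t ↦ by rw [sharp_ofReal]
    rw [this]
    exact ((Complex.continuous_conj.measurable.comp h1).mul
      hφ.1.continuous.measurable).aestronglyMeasurable
  have hφi : Integrable (fun t : ℝ ↦ ‖φ t‖) :=
    (hφ.1.continuous.integrable_of_hasCompactSupport hφ.2).norm
  refine (hφi.const_mul (K * ((1 + Real.log (2 + |x|)) / (1 + |x|)))).mono' hmeas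
    (ae_of_all _ fun t ↦ ?_)
  rw [norm_mul, sharp_ofReal, Complex.norm_conj]
  by_cases ht : |t| ≤ R
  · exact mul_le_mul_of_nonneg_right (hK t x ht) (norm_nonneg _)
  · have h0 : φ t = 0 := hR t (by rw [Real.norm_eq_abs]; linarith)
    simp [h0]

/-- `P̂_{φ₁+φ₂}(x) = P̂_{φ₁}(x) + P̂_{φ₂}(x)` for `φᵢ ∈ C_c^∞(ℝ)` and real `x`. [folklore] -/
private theorem screwPhat_add {φ₁ φ₂ : ℝ → ℂ} (h₁ : IsWeilTest φ₁) (h₂ : IsWeilTest φ₂) (x : ℝ) :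
    screwPhat (φ₁ + φ₂) x = screwPhat φ₁ x + screwPhat φ₂ x := by
  unfold screwPhat
  rw [← integral_add (integrable_screwPhat_integrand h₁ x) (integrable_screwPhat_integrand h₂ x)]
  congr 1 with t
  simp only [Pi.add_apply]
  ring

/-- `‖hf.toLp f‖_{L²} = (∫‖f‖²)^{1/2}`. [folklore] -/
private theorem norm_toLp_two_eq_sqrt {f : ℝ → ℂ} (hf : MemLp f 2 volume) :
    ‖hf.toLp f‖ = Real.sqrt (∫ x, ‖f x‖ ^ 2) := by
  rw [Lp.norm_toLp, hf.eLpNorm_eq_integral_rpow_norm two_ne_zero ENNReal.ofNat_ne_top,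
    ENNReal.toReal_ofReal (by positivity), ENNReal.toReal_ofNat, Real.sqrt_eq_rpow,
    show ((2 : ℝ))⁻¹ = 1 / 2 by norm_num]
  congr 1
  refine integral_congr_ae (ae_of_all _ fun x ↦ ?_)
  simp

/-- **CJM Lemma 3.2 (i)** (RH-FREE): `‖ψ₁ + ψ₂‖₀ ≤ ‖ψ₁‖₀ + ‖ψ₂‖₀` on `C_c^∞(ℝ)` — the first conjunct
of `Suzuki2025_lemma32`, by Minkowski in `L²(ℝ)` (Prop 1.3) and linearity of `ψ ↦ P̂_{Dψ}`.
[cite: Suzuki2025WeilHilbertSpace, Lemma 3.2 (TeX l.1073–1079)] -/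
theorem Suzuki2025_lemma32_subadd {ψ₁ ψ₂ : ℝ → ℂ} (h₁ : IsWeilTest ψ₁) (h₂ : IsWeilTest ψ₂) :
    screwNormZero (ψ₁ + ψ₂) ≤ screwNormZero ψ₁ + screwNormZero ψ₂ := by
  have hD₁ := isWeilTest_suzukiD h₁
  have hD₂ := isWeilTest_suzukiD h₂
  have hf₁ := memLp_screwPhat hD₁
  have hf₂ := memLp_screwPhat hD₂
  have hpt : ∀ x : ℝ, screwPhat (suzukiD (ψ₁ + ψ₂)) x =
      screwPhat (suzukiD ψ₁) x + screwPhat (suzukiD ψ₂) x := fun x ↦ by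
    rw [suzukiD_add h₁ h₂, screwPhat_add hD₁ hD₂]
  unfold screwNormZero
  simp only [hpt]
  rw [Real.sqrt_div' _ Real.pi_pos.le, Real.sqrt_div' _ Real.pi_pos.le,
    Real.sqrt_div' _ Real.pi_pos.le, ← add_div]
  gcongr
  have e : Real.sqrt (∫ x : ℝ, ‖screwPhat (suzukiD ψ₁) x + screwPhat (suzukiD ψ₂) x‖ ^ 2) =
      ‖(hf₁.add hf₂).toLp _‖ := by
    rw [norm_toLp_two_eq_sqrt]; rfl
  rw [e, MemLp.toLp_add, ← norm_toLp_two_eq_sqrt hf₁, ← norm_toLp_two_eq_sqrt hf₂]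
  exact norm_add_le _ _

/-- **CJM Lemma 3.2 (ii)** (RH-FREE): `‖kψ‖₀ = |k|‖ψ‖₀` — the second conjunct of
`Suzuki2025_lemma32`. [cite: Suzuki2025WeilHilbertSpace, Lemma 3.2 (TeX l.1073–1079)] -/
theorem Suzuki2025_lemma32_absHom (k : ℂ) {ψ : ℝ → ℂ} (h : IsWeilTest ψ) :
    screwNormZero (k • ψ) = ‖k‖ * screwNormZero ψ := by
  have hpt : ∀ x : ℝ, screwPhat (suzukiD (k • ψ)) x = k * screwPhat (suzukiD ψ) x := fun x ↦ by
    rw [suzukiD_smul h k, screwPhat_const_mul]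
  unfold screwNormZero
  simp only [hpt, norm_mul, mul_pow]
  rw [integral_const_mul, mul_div_assoc, Real.sqrt_mul (sq_nonneg _), Real.sqrt_sq (norm_nonneg _)]

/-- **CJM Lemma 3.2 reduced to definiteness**: given (iii) `‖ψ‖₀ = 0 ⇒ ψ = 0` on `C_c^∞(ℝ)` (which in
print rests on (3.5)/(3.8) and [Suzuki JLMS 2023, Lemma 2.1]), the named fact `Suzuki2025_lemma32`
holds. [cite: Suzuki2025WeilHilbertSpace, Lemma 3.2 (TeX l.1073–1093)] -/
theorem Suzuki2025_lemma32_of_definite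
    (h3 : ∀ ψ : ℝ → ℂ, IsWeilTest ψ → screwNormZero ψ = 0 → ψ = 0) : Suzuki2025_lemma32 :=
  ⟨fun _ _ h₁ h₂ ↦ Suzuki2025_lemma32_subadd h₁ h₂, fun k _ h ↦ Suzuki2025_lemma32_absHom k h, h3⟩

/-! ## CJM Thm 4.4 from Thm 4.2 (Fubini on (4.4)); Thm 1.4 from Thm 4.4

Under RH, (4.4) `(1/π)⟨𝔖_t, 𝔖_u⟩ = G_g(t,u)` gives, for `φ ∈ C_c^∞(ℝ)`,
`‖P̂_φ‖² = ∫_x |∫_t 𝔖_t♯(x)φ(t)dt|² dx = ∫∫ φ(t)conj φ(u) ⟨𝔖_u,𝔖_t⟩ du dt = π⟨φ,φ⟩_{G_g}` (4.8), by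
Fubini (the integrand is dominated by `36K_R²(1+|x|)^{-3/2}|φ(t)||φ(u)|`, the Prop 1.2/1.3 bounds).
The RH-free `⇐` halves and the reductions `Suzuki2025_thm44_of_onlyIf`, `Suzuki2025_cor43_of_thm42`
are dbl-t6's `SuzukiScrewLineDoorProofs.lean` (imported). -/

/-- `|z|² = z·z̄` as a cast identity. [folklore] -/
private theorem ofReal_norm_sq_eq_mul_conj (z : ℂ) : ((‖z‖ ^ 2 : ℝ) : ℂ) = z * conj z := by
  rw [Complex.mul_conj, Complex.normSq_eq_norm_sq, Complex.ofReal_pow]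


end ScrewLineL2

/-- **CJM Prop 1.2 (= arXiv:2209.04658 Prop 1.1), DISCHARGED — RH-FREE**: for every real `t`,
`x ↦ 𝔖_t(x)` belongs to `L²(ℝ)`. Proof: `𝔖_0 ≡ 0`; for `t ≠ 0` the global bound
`|𝔖_t(x)| ≤ K_t(1 + log(2+|x|))/(1+|x|) ≤ 6K_t(1+|x|)^{-3/4}` (`ScrewLineL2.norm_screwLine_le_log`,
from the cancellation `|(1+Θ♯)ξ′/ξ| ≤ 2` and the digamma bounds) and measurability.
[cite: Suzuki2025WeilHilbertSpace, Prop. 1.2 (TeX l.376–383) and §3.2 (TeX l.985–1015)] -/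
theorem Suzuki2025_prop12_holds : Suzuki2025_prop12 := fun t ↦ ScrewLineL2.memLp_screwLine t

/-- **CJM Prop 1.3 (= arXiv:2209.04658 Prop 1.2), DISCHARGED — RH-FREE**: for `φ ∈ C_c^∞(ℝ)`,
`x ↦ P̂_φ(x) = ∫ 𝔖_t♯(x)φ(t)dt` belongs to `L²(ℝ)`. Proof as printed (local uniformity in `t` of the
bound of Prop 1.2, then domination): `|P̂_φ(x)| ≤ 6K_R‖φ‖₁(1+|x|)^{-3/4}` for `supp φ ⊆ [−R,R]`
(`ScrewLineL2.norm_screwLine_le_log_unif`), and Fubini measurability.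
[cite: Suzuki2025WeilHilbertSpace, Prop. 1.3 (TeX l.392–405)] -/
theorem Suzuki2025_prop13_holds : Suzuki2025_prop13 := fun _ hφ ↦ ScrewLineL2.memLp_screwPhat hφ

open ScrewLineL2 in
/-- **CJM Thm 4.4, (4.8) from (4.4)**: granted the first clause of Thm 4.2 (the screw-line identity
(4.4) under RH), `‖P̂_φ‖²_{L²(ℝ)} = π⟨φ,φ⟩_{G_g}` for every `φ ∈ C_c^∞(ℝ)`, under RH — by Fubini
("the right-hand side [of (4.4)] multiplied by `φ(t)conj φ(u)` and integrated equals
`π⟨φ,φ⟩_{G_g}`", TeX l.1400–1410). [cite: Suzuki2025WeilHilbertSpace, Thm. 4.4 proof (TeX l.1396–1412)] -/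
theorem Suzuki2025_thm44_mp_of_thm42 (h42 : Suzuki2025_thm42) (hRH : RiemannHypothesis)
    {φ : ℝ → ℂ} (hφ : IsWeilTest φ) :
    ((∫ x : ℝ, ‖screwPhat φ x‖ ^ 2 : ℝ) : ℂ) = Real.pi * zetaScrewForm univ φ φ := by
  have h44 := (h42 hRH).1
  obtain ⟨R, -, hR⟩ := hφ.2.exists_pos_le_norm
  obtain ⟨K, hK0, hK⟩ := norm_screwLine_le_log_unif R
  have hφc : Continuous φ := hφ.1.continuous
  have hφn : Integrable (fun t : ℝ ↦ ‖φ t‖) := (hφc.integrable_of_hasCompactSupport hφ.2).norm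
  have hφR : ∀ t : ℝ, R < |t| → φ t = 0 := fun t ht ↦ hR t (by rw [Real.norm_eq_abs]; exact ht.le)
  -- pointwise decay `‖𝔖_t(x)‖ ≤ 6K(1+|x|)^{-3/4}` for `|t| ≤ R`
  have hdec : ∀ t x : ℝ, |t| ≤ R → ‖screwLine t x‖ ≤ 6 * K * (1 + |x|) ^ (-(3 / 4 : ℝ)) := by
    intro t x ht
    refine (hK t x ht).trans ?_
    have := one_add_log_div_le x
    calc K * ((1 + Real.log (2 + |x|)) / (1 + |x|)) ≤ K * (6 * (1 + |x|) ^ (-(3 / 4 : ℝ))) := by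
          gcongr
      _ = 6 * K * (1 + |x|) ^ (-(3 / 4 : ℝ)) := by ring
  -- the triple integrand
  set F : ℝ → ℝ × ℝ → ℂ := fun x p ↦
    ((starRingEnd ℂ) (screwLine p.1 (x : ℂ)) * φ p.1) * (screwLine p.2 (x : ℂ) * (starRingEnd ℂ) (φ p.2))
    with hF
  -- Step 1: `|P̂_φ(x)|² = ∫∫ F(x; t, u)`
  have hstep1 : ∀ x : ℝ, ((‖screwPhat φ x‖ ^ 2 : ℝ) : ℂ) = ∫ p : ℝ × ℝ, F x p := by
    intro x
    rw [ofReal_norm_sq_eq_mul_conj]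
    have hP : screwPhat φ x = ∫ t : ℝ, (starRingEnd ℂ) (screwLine t (x : ℂ)) * φ t := by
      unfold screwPhat
      exact integral_congr_ae (ae_of_all _ fun t ↦ by simp only [sharp_ofReal])
    have hPc : (starRingEnd ℂ) (screwPhat φ x) =
        ∫ u : ℝ, screwLine u (x : ℂ) * (starRingEnd ℂ) (φ u) := by
      rw [hP, ← integral_conj]
      exact integral_congr_ae (ae_of_all _ fun u ↦ by simp)
    rw [hPc, hP, ← integral_prod_mul]
    rfl
  -- Step 2: integrability of the triple integrand
  have hmeasS : ∀ (g : ℝ × (ℝ × ℝ) → ℝ), Measurable g →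
      Measurable fun q : ℝ × (ℝ × ℝ) ↦ screwLine (g q) ((q.1 : ℝ) : ℂ) := by
    intro g hg
    have h := measurable_screwLine_uncurry.comp (measurable_fst.prodMk hg)
    simpa only [Function.comp_def] using h
  have hFm : Measurable (Function.uncurry F) := by
    have m1 : Measurable fun q : ℝ × (ℝ × ℝ) ↦ screwLine q.2.1 ((q.1 : ℝ) : ℂ) :=
      hmeasS (fun q ↦ q.2.1) (measurable_fst.comp measurable_snd)
    have m2 : Measurable fun q : ℝ × (ℝ × ℝ) ↦ screwLine q.2.2 ((q.1 : ℝ) : ℂ) :=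
      hmeasS (fun q ↦ q.2.2) (measurable_snd.comp measurable_snd)
    have mφ1 : Measurable fun q : ℝ × (ℝ × ℝ) ↦ φ q.2.1 :=
      hφc.measurable.comp (measurable_fst.comp measurable_snd)
    have mφ2 : Measurable fun q : ℝ × (ℝ × ℝ) ↦ φ q.2.2 :=
      hφc.measurable.comp (measurable_snd.comp measurable_snd)
    exact ((Complex.continuous_conj.measurable.comp m1).mul mφ1).mul
      (m2.mul (Complex.continuous_conj.measurable.comp mφ2))
  have hxint : Integrable (fun x : ℝ ↦ (1 + |x|) ^ (-(3 / 2 : ℝ))) := by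
    have hint := integrable_one_add_norm (E := ℝ) (μ := volume) (r := 3 / 2)
      (by rw [Module.finrank_self]; norm_num)
    refine hint.congr (ae_of_all _ fun x ↦ ?_)
    simp only [Real.norm_eq_abs]
  have hB : Integrable (fun q : ℝ × (ℝ × ℝ) ↦
      ((6 * K) ^ 2 * (1 + |q.1|) ^ (-(3 / 2 : ℝ))) * (‖φ q.2.1‖ * ‖φ q.2.2‖)) :=
    (hxint.const_mul _).mul_prod (hφn.mul_prod hφn)
  have hFint : Integrable (Function.uncurry F) (volume.prod volume) := by
    refine hB.mono' hFm.aestronglyMeasurable (ae_of_all _ fun q ↦ ?_)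
    obtain ⟨x, t, u⟩ := q
    simp only [Function.uncurry_apply_pair, hF]
    rw [norm_mul, norm_mul, norm_mul, Complex.norm_conj, Complex.norm_conj]
    have hpow : 0 ≤ (1 + |x|) ^ (-(3 / 2 : ℝ)) := Real.rpow_nonneg (by positivity) _
    have hpow' : ((1 + |x|) ^ (-(3 / 4 : ℝ))) * ((1 + |x|) ^ (-(3 / 4 : ℝ))) =
        (1 + |x|) ^ (-(3 / 2 : ℝ)) := by
      rw [← Real.rpow_add (by positivity)]; norm_num
    by_cases ht : |t| ≤ R
    · by_cases hu : |u| ≤ R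
      · have h1 := hdec t x ht
        have h2 := hdec u x hu
        calc ‖screwLine t x‖ * ‖φ t‖ * (‖screwLine u x‖ * ‖φ u‖)
            = (‖screwLine t x‖ * ‖screwLine u x‖) * (‖φ t‖ * ‖φ u‖) := by ring
          _ ≤ (6 * K * (1 + |x|) ^ (-(3 / 4 : ℝ))) * (6 * K * (1 + |x|) ^ (-(3 / 4 : ℝ))) *
                (‖φ t‖ * ‖φ u‖) := by
              exact mul_le_mul_of_nonneg_right (mul_le_mul h1 h2 (norm_nonneg _) (by positivity))
                (by positivity)
          _ = (6 * K) ^ 2 * (1 + |x|) ^ (-(3 / 2 : ℝ)) * (‖φ t‖ * ‖φ u‖) := by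
              rw [← hpow']; ring
      · have : φ u = 0 := hφR u (lt_of_not_ge hu)
        simp only [this, norm_zero, mul_zero]
        all_goals positivity
    · have : φ t = 0 := hφR t (lt_of_not_ge ht)
      simp only [this, norm_zero, mul_zero, zero_mul]
      all_goals positivity
  -- Step 3: the inner `x`-integral, by (4.4)
  have hinner : ∀ p : ℝ × ℝ, ∫ x : ℝ, F x p =
      φ p.1 * (starRingEnd ℂ) (φ p.2) * (Real.pi * (zetaScrewKernel p.2 p.1 : ℂ)) := by
    intro p
    have h := h44 p.2 p.1
    have hπ : (Real.pi : ℂ) ≠ 0 := Complex.ofReal_ne_zero.2 Real.pi_ne_zero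
    have hI : ∫ x : ℝ, screwLine p.2 x * (starRingEnd ℂ) (screwLine p.1 x) =
        Real.pi * (zetaScrewKernel p.2 p.1 : ℂ) := by
      rw [← h]; field_simp
    rw [← hI, ← integral_const_mul]
    refine integral_congr_ae (ae_of_all _ fun x ↦ ?_)
    simp only [hF]
    ring
  -- Step 4: the `(t,u)`-integrand is integrable (continuous, compact support)
  have hH : Integrable (fun p : ℝ × ℝ ↦
      (zetaScrewKernel p.1 p.2 : ℂ) * φ p.2 * (starRingEnd ℂ) (φ p.1)) := by
    have hKc : Continuous fun p : ℝ × ℝ ↦ (zetaScrewKernel p.1 p.2 : ℂ) := by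
      refine Complex.continuous_ofReal.comp ?_
      unfold zetaScrewKernel
      exact ((continuous_zetaScrew.comp continuous_fst).add
        (continuous_zetaScrew.comp continuous_snd)).sub
        (continuous_zetaScrew.comp (continuous_fst.sub continuous_snd))
    have hc : Continuous fun p : ℝ × ℝ ↦
        (zetaScrewKernel p.1 p.2 : ℂ) * φ p.2 * (starRingEnd ℂ) (φ p.1) :=
      (hKc.mul (hφc.comp continuous_snd)).mul
        (Complex.continuous_conj.comp (hφc.comp continuous_fst))
    refine hc.integrable_of_hasCompactSupport ?_
    refine HasCompactSupport.intro ((isCompact_closedBall (0 : ℝ) R).prod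
      (isCompact_closedBall (0 : ℝ) R)) fun p hp ↦ ?_
    rw [Set.mem_prod, Metric.mem_closedBall, Metric.mem_closedBall, dist_zero_right,
      dist_zero_right, Real.norm_eq_abs, Real.norm_eq_abs, not_and_or, not_le, not_le] at hp
    rcases hp with h1 | h2
    · rw [hφR p.1 h1, map_zero, mul_zero]
    · rw [hφR p.2 h2, mul_zero, zero_mul]
  -- assemble
  calc ((∫ x : ℝ, ‖screwPhat φ x‖ ^ 2 : ℝ) : ℂ)
      = ∫ x : ℝ, ((‖screwPhat φ x‖ ^ 2 : ℝ) : ℂ) := integral_ofReal.symm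
    _ = ∫ x : ℝ, ∫ p : ℝ × ℝ, F x p := integral_congr_ae (ae_of_all _ hstep1)
    _ = ∫ p : ℝ × ℝ, ∫ x : ℝ, F x p := integral_integral_swap hFint
    _ = ∫ p : ℝ × ℝ, φ p.1 * (starRingEnd ℂ) (φ p.2) * (Real.pi * (zetaScrewKernel p.2 p.1 : ℂ)) :=
        integral_congr_ae (ae_of_all _ hinner)
    _ = Real.pi * ∫ p : ℝ × ℝ, (zetaScrewKernel p.2 p.1 : ℂ) * φ p.1 * (starRingEnd ℂ) (φ p.2) := by
        rw [← integral_const_mul]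
        exact integral_congr_ae (ae_of_all _ fun p ↦ by ring)
    _ = Real.pi * ∫ p : ℝ × ℝ, (zetaScrewKernel p.1 p.2 : ℂ) * φ p.2 * (starRingEnd ℂ) (φ p.1) := by
        congr 1
        rw [Measure.volume_eq_prod]
        exact integral_prod_swap
          (fun q : ℝ × ℝ ↦ (zetaScrewKernel q.1 q.2 : ℂ) * φ q.2 * (starRingEnd ℂ) (φ q.1))
    _ = Real.pi * zetaScrewForm univ φ φ := by
        congr 1
        have hH' : Integrable (fun p : ℝ × ℝ ↦
            (zetaScrewKernel p.1 p.2 : ℂ) * φ p.2 * (starRingEnd ℂ) (φ p.1)) (volume.prod volume) := hH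
        rw [Measure.volume_eq_prod, integral_prod _ hH']
        unfold zetaScrewForm
        simp only [Measure.restrict_univ]

/-- **CJM Thm 4.4 from Thm 4.2**: the named fact `Suzuki2025_thm44` follows from `Suzuki2025_thm42`
((4.8) under RH by Fubini on (4.4), `Suzuki2025_thm44_mp_of_thm42`; clause (i) `⇐` is dbl-t6's
RH-free door `Suzuki2025_thm44_mpr`, packaged as `Suzuki2025_thm44_of_onlyIf`).
[cite: Suzuki2025WeilHilbertSpace, Thm. 4.4 (TeX l.1281–1298, proof l.1396–1412)] -/
theorem Suzuki2025_thm44_of_thm42 (h42 : Suzuki2025_thm42) : Suzuki2025_thm44 :=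
  Suzuki2025_thm44_of_onlyIf fun hRH _ hφ ↦ Suzuki2025_thm44_mp_of_thm42 h42 hRH hφ

/-- (4.10) on the diagonal for `D = i d/dt`: `⟨Dψ, Dψ⟩_{G_g} = ⟨ψ,ψ⟩_W` (`ψ ∈ C_c^∞(ℝ)`) — the factor
`i` cancels in the hermitian form, so this is dbl-t6's `zetaScrewForm_univ_deriv_eq_weilQuadratic`
(= Suzuki JLMS 2023 Prop 3.1, `Suzuki2023_prop31_holds`, window `ℝ²`).
[cite: Suzuki2025WeilHilbertSpace, (4.10) (TeX l.1312–1324); Suzuki2023, Prop. 3.1] -/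
theorem zetaScrewForm_univ_suzukiD {ψ : ℝ → ℂ} (hψ : IsWeilTest ψ) :
    zetaScrewForm univ (suzukiD ψ) (suzukiD ψ) = weilQuadratic ψ := by
  rw [← zetaScrewForm_univ_deriv_eq_weilQuadratic hψ]
  unfold zetaScrewForm
  refine integral_congr_ae (ae_of_all _ fun t ↦ ?_)
  refine integral_congr_ae (ae_of_all _ fun u ↦ ?_)
  simp only [suzukiD, map_mul, Complex.conj_I]
  ring_nf
  rw [Complex.I_sq]
  ring

/-- **CJM Thm 1.4 from Thm 4.4**: the criterion `RH ⟺ (1.9) ∀ψ ∈ C_c^∞(ℝ)` follows from clause (ii)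
of `Suzuki2025_thm44` (RH ⇒ (4.8) on `C_c^∞(ℝ)`) at `φ = Dψ` and (4.10)
(`zetaScrewForm_univ_suzukiD`); the `⇐` direction is the RH-free `Suzuki2025_thm14_if`. This is the
printed derivation of Thm 1.4 from Thm 4.4 (§4.3). [cite: Suzuki2025WeilHilbertSpace, §4.3 (TeX l.1300–1345)] -/
theorem Suzuki2025_thm14_of_thm44 (h44 : Suzuki2025_thm44) : Suzuki2025_thm14 := by
  refine ⟨fun hRH ψ hψ ↦ ?_, Suzuki2025_thm14_if⟩
  have hD : IsWeilTest (suzukiD ψ) := by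
    unfold suzukiD
    exact hψ.deriv.const_mul I
  rw [h44.2 hRH (suzukiD ψ) hD, zetaScrewForm_univ_suzukiD hψ]

/-- **CJM Thm 1.4 from Thm 4.2** (composition of the two reductions above). The remaining
undischarged input of the whole §1/§4 criterion chain of this file is thus Thm 4.2 (⟸ Prop 3.1, the
explicit formula for `𝔓_t`, and Prop 4.1, the orthonormal basis of `𝒦(Θ_ξ)` under RH).
[cite: Suzuki2025WeilHilbertSpace, §4.2–4.3] -/
theorem Suzuki2025_thm14_of_thm42 (h42 : Suzuki2025_thm42) : Suzuki2025_thm14 :=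
  Suzuki2025_thm14_of_thm44 (Suzuki2025_thm44_of_thm42 h42)

/-! ## Public generalisations of the Prop 1.3 estimates (integrable weights with bounded support)

The majorant behind Prop 1.3 uses only that the weight `g` in `P̂_g(x) = ∫ 𝔖_t♯(x) g(t) dt` is
measurable, integrable and vanishes off a bounded interval; half-line cut-offs `1_{[0,∞)}φ` of test
functions (needed for the repaired screw line over all real `t`, cell row G-dbl-31,
`SuzukiScrewLineRepaired.lean`) are not smooth, so the estimates are re-exposed in that generality.
RH-FREE. [cite: Suzuki2025WeilHilbertSpace, Prop. 1.3 (TeX l.392–405)] -/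

namespace ScrewLineL2

/-- Joint measurability of `(x, t) ↦ 𝔖_t(x)` on `ℝ × ℝ` (public form; the measurability half of the
Minkowski step of Prop 1.3). [cite: Suzuki2025WeilHilbertSpace, Prop. 1.3 (TeX l.392–405)] -/
theorem measurable_screwLine_uncurry' : Measurable fun p : ℝ × ℝ ↦ screwLine p.2 (p.1 : ℂ) :=
  measurable_screwLine_uncurry

/-- `t ↦ 𝔖_t(x)` is measurable for every real `x` (so that (1.7) is a Bochner integral).
[cite: Suzuki2025WeilHilbertSpace, eq. (1.7) (TeX l.395–405)] -/
theorem measurable_screwLine_left (x : ℝ) : Measurable fun t : ℝ ↦ screwLine t (x : ℂ) := by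
  have h := measurable_screwLine_uncurry.comp ((measurable_const (a := x)).prodMk measurable_id)
  simpa only [Function.comp_def, id_eq] using h

/-- The majorant `(1+|x|)^{-3/4}` is in `L²(ℝ)` (public form of the Prop 1.2 majorant
`𝔖_t(z) ≪ |z|^{-1} log|z|`). [cite: Suzuki2025WeilHilbertSpace, Prop. 1.2, proof §3.2 (TeX l.1005–1015)] -/
theorem memLp_two_rpow_majorant' : MemLp (fun x : ℝ ↦ (1 + |x|) ^ (-(3 / 4 : ℝ))) 2 volume :=
  memLp_two_rpow_majorant

/-- `(1 + log(2+|x|))/(1+|x|) ≤ 6(1+|x|)^{-3/4}` (public form of the Prop 1.2 majorant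
`𝔖_t(z) ≪ |z|^{-1} log|z|`). [cite: Suzuki2025WeilHilbertSpace, Prop. 1.2, proof §3.2 (TeX l.1005–1015)] -/
theorem one_add_log_div_le' (x : ℝ) :
    (1 + Real.log (2 + |x|)) / (1 + |x|) ≤ 6 * (1 + |x|) ^ (-(3 / 4 : ℝ)) :=
  one_add_log_div_le x

/-- The integrand `t ↦ 𝔖_t♯(x) g(t)` of `P̂_g(x)` is integrable for every measurable, integrable `g`
vanishing off `{|t| ≤ R}`, at every real `x` (uniformity of the Prop 1.2 bound on compacts in `t`).
[cite: Suzuki2025WeilHilbertSpace, Prop. 1.3 (TeX l.392–405)] -/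
theorem integrable_screwPhat_integrand_of_support {g : ℝ → ℂ} (hgm : Measurable g)
    (hg : Integrable g) {R : ℝ} (hR : ∀ t, R < |t| → g t = 0) (x : ℝ) :
    Integrable (fun t : ℝ ↦ sharp (screwLine t) (x : ℂ) * g t) := by
  obtain ⟨K, hK0, hK⟩ := norm_screwLine_le_log_unif R
  have hmeas : AEStronglyMeasurable (fun t : ℝ ↦ sharp (screwLine t) (x : ℂ) * g t) volume := by
    have : (fun t : ℝ ↦ sharp (screwLine t) (x : ℂ) * g t) =
        fun t ↦ (starRingEnd ℂ) (screwLine t (x : ℂ)) * g t := funext fun t ↦ by rw [sharp_ofReal]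
    rw [this]
    exact ((Complex.continuous_conj.measurable.comp (measurable_screwLine_left x)).mul
      hgm).aestronglyMeasurable
  refine ((hg.norm).const_mul (K * ((1 + Real.log (2 + |x|)) / (1 + |x|)))).mono' hmeas
    (ae_of_all _ fun t ↦ ?_)
  rw [norm_mul, sharp_ofReal, Complex.norm_conj]
  by_cases ht : |t| ≤ R
  · exact mul_le_mul_of_nonneg_right (hK t x ht) (norm_nonneg _)
  · have h0 : g t = 0 := hR t (lt_of_not_ge ht)
    simp [h0]

/-- `x ↦ P̂_g(x)` is a.e.-strongly measurable for every measurable weight `g` (Fubini measurability in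
the Minkowski step of Prop 1.3). [cite: Suzuki2025WeilHilbertSpace, Prop. 1.3 (TeX l.392–405)] -/
theorem aestronglyMeasurable_screwPhat_of_measurable {g : ℝ → ℂ} (hgm : Measurable g) :
    AEStronglyMeasurable (fun x : ℝ ↦ screwPhat g x) volume := by
  have hF : Measurable (fun p : ℝ × ℝ ↦ sharp (screwLine p.2) (p.1 : ℂ) * g p.2) := by
    have : (fun p : ℝ × ℝ ↦ sharp (screwLine p.2) (p.1 : ℂ) * g p.2) =
        fun p ↦ (starRingEnd ℂ) (screwLine p.2 (p.1 : ℂ)) * g p.2 :=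
      funext fun p ↦ by rw [sharp_ofReal]
    rw [this]
    exact (Complex.continuous_conj.measurable.comp measurable_screwLine_uncurry).mul
      (hgm.comp measurable_snd)
  exact (StronglyMeasurable.integral_prod_right
    (f := fun (x : ℝ) (t : ℝ) ↦ sharp (screwLine t) (x : ℂ) * g t) hF.stronglyMeasurable
      (ν := volume)).aestronglyMeasurable

/-- Pointwise majorant `‖P̂_g(x)‖ ≤ 6K_R‖g‖₁ (1+|x|)^{-3/4}` for an integrable weight `g` vanishing off
`{|t| ≤ R}`. [cite: Suzuki2025WeilHilbertSpace, Prop. 1.3 (TeX l.392–405)] -/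
theorem norm_screwPhat_le_of_support {g : ℝ → ℂ} (hg : Integrable g) {R : ℝ}
    (hR : ∀ t, R < |t| → g t = 0) :
    ∃ C : ℝ, ∀ x : ℝ, ‖screwPhat g x‖ ≤ C * (1 + |x|) ^ (-(3 / 4 : ℝ)) := by
  obtain ⟨K, hK0, hK⟩ := norm_screwLine_le_log_unif R
  have hgi : Integrable (fun t : ℝ ↦ ‖g t‖) := hg.norm
  refine ⟨6 * K * ∫ t, ‖g t‖, fun x ↦ ?_⟩
  have hpow : 0 ≤ (1 + |x|) ^ (-(3 / 4 : ℝ)) := Real.rpow_nonneg (by positivity) _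
  have hbound : ∀ t : ℝ, ‖sharp (screwLine t) (x : ℂ) * g t‖ ≤
      6 * K * (1 + |x|) ^ (-(3 / 4 : ℝ)) * ‖g t‖ := by
    intro t
    rw [norm_mul, sharp_ofReal, Complex.norm_conj]
    by_cases ht : |t| ≤ R
    · gcongr
      refine (hK t x ht).trans ?_
      have := one_add_log_div_le x
      calc K * ((1 + Real.log (2 + |x|)) / (1 + |x|)) ≤ K * (6 * (1 + |x|) ^ (-(3 / 4 : ℝ))) := by
            gcongr
        _ = 6 * K * (1 + |x|) ^ (-(3 / 4 : ℝ)) := by ring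
    · have h0 : g t = 0 := hR t (lt_of_not_ge ht)
      simp [h0]
  unfold screwPhat
  calc ‖∫ t, sharp (screwLine t) (x : ℂ) * g t‖
      ≤ ∫ t, 6 * K * (1 + |x|) ^ (-(3 / 4 : ℝ)) * ‖g t‖ :=
        norm_integral_le_of_norm_le (hgi.const_mul _) (ae_of_all _ hbound)
    _ = 6 * K * (∫ t, ‖g t‖) * (1 + |x|) ^ (-(3 / 4 : ℝ)) := by
        rw [integral_const_mul]; ring

/-- **`P̂_g ∈ L²(ℝ)`** for every measurable, integrable weight `g` vanishing off `{|t| ≤ R}`.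
[cite: Suzuki2025WeilHilbertSpace, Prop. 1.3 (TeX l.392–405)] -/
theorem memLp_screwPhat_of_support {g : ℝ → ℂ} (hgm : Measurable g) (hg : Integrable g) {R : ℝ}
    (hR : ∀ t, R < |t| → g t = 0) :
    MemLp (fun x : ℝ ↦ screwPhat g x) 2 volume := by
  obtain ⟨C, hC⟩ := norm_screwPhat_le_of_support hg hR
  exact (memLp_two_rpow_majorant.const_mul C).mono' (aestronglyMeasurable_screwPhat_of_measurable hgm)
    (ae_of_all _ hC)

end ScrewLineL2

end Literature.NumberTheory.LFunctions

end
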